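import Mathlib.Analysis.SpecialFunctions.Pow.Asymptotics
import Literature.NumberTheory.Sieve.AsymptoticSieveForPrimesDecomposition
import Literature.NumberTheory.Sieve.AsymptoticSieveForPrimesReduction
import HarnessLib

/-!
# Asymptotic sieve for primes: the estimate (6.6) for `S₁(x; y, z)` (proof)

Trunk T-SIEVE. Source: J. Friedlander, H. Iwaniec, *Asymptotic sieve for primes*, Ann. of Math. 148
(1998) 1041–1065 [FriedlanderIwaniecASP1998] (= arXiv:math/9811186), §6 "Estimation of
`S₁(x; Y, Z)`", pp. 1054–1056, displays (6.1)–(6.6).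

This file DISCHARGES the named fact `Literature.NumberTheory.Sieve.fi_asp_S1_estimate`
(`Literature.NumberTheory.Sieve.AsymptoticSieveForPrimesDecomposition`; FI (6.6):
"`S₁(x; y, z) ≪ A(x) log δ / log Δ`") from the tree: the reduced remainder bound (R′)
(`Literature.NumberTheory.Sieve.fi_reduced_remainder_bound_holds`, `…Reduction`), the positivity of upper-bound sieve weights
against multiplicative functions (`Literature.NumberTheory.Sieve.IsUpperSieveWeights.sum_mul_nonneg`, `…Inputs`), and the
hypotheses (1.8), (1.9), (1.16), (R1) of Theorem 1; the sieve bound of FI §6 ("the sieve theory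
applies giving `∑_ν λ_ν g(ν)h(ν) ≪ ∏_{p<Δ} (1 - g(p)h(p))`") is, as in the statement of the fact, a
hypothesis on the weights. Everything here is a theorem; no statement of the tree is modified.

## The argument (FI §6 with explicit ranges and constants)

Fix `x` large, an admissible `s` and `y, z ∈ [Y, eY]`; put `u = sy`, `v = sz`, `δ = (log x)^α`,
`U = √x/(8δ)` (so `u, v > sY = U`), sieve weights `λ = lam x` of sifting range `z₁ = x^{θ₁}` and
level `x^{θ/2}`, `g` the density.
* Dropping `μ(b)` (FI p. 1055): `|Λ₁(n; y, z)| = |∑_{bce = n, b > u, c > v} μ(b)Λ(c)|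
  ≤ ∑_{(c, e) ∈ Q, ce ∣ n} Λ(c)` with `Q = {v < c ≤ x/u} × {1 ≤ e ≤ x/(uv)}`
  (`abs_truncGT_moebius_mul_truncGT_vonMangoldt_mul_zeta_le`; the ranges (6.1)–(6.2):
  `c ≤ x/u < 8δ√x`, `e ≤ x/(uv) < 64δ²`), hence
  `|S₁| ≤ ∑_{(c,e) ∈ Q} Λ(c) ∑_{n ≤ x, ce ∣ n} a_n ρ_n`.
* `∑_{n ≤ x, k ∣ n} a_n ρ_n = ∑_{ν ∣ P(z₁)} λ_ν A_{[k, ν]}(x)`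
  `= A(x) ∑'_ν λ_ν g([k,ν]) + ∑'_ν λ_ν r_{[k,ν]}(x)`,
  `∑'` over `ν` with `[k, ν]` squarefree (the other `A_{[k,ν]}(x)` vanish by (1.16))
  (`IsUpperSieveWeights.sum_filter_dvd_a_mul_sieveRho_eq_main_add_rem`; FI: "We insert (1.7)").
* Remainder (FI: "estimate the resulting remainder by (R′)"; `[cd, ν] ≤ cdν < δ³Δ√x < D`): each
  squarefree `m = [ce, ν] ≤ 512 δ³ x^{1/2+θ/2} ≤ D(x)` is hit with total weight
  `∑ Λ(c) ≤ log m · τ(m)² ≤ log x · τ₅(m)`, so the remainder is `≤ log x · K_R A(x)(log x)^{-3}`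
  (`abs_sum_vonMangoldt_mul_rem_le`, `fi_reduced_remainder_bound_holds`).
* Main term `A(x) L(x) M(x)` (FI (6.3)): `c` is a prime `> U > x^{θ/2} ≥ ν, e`, so
  `[ce, ν] = c [e, ν]`, `g([ce, ν]) = g(c) g([e, ν])` (`sum_lcm_prime_mul_eq`), giving
  `L(x) = ∑_{c prime ∈ (v, x/u]} g(c) log c` and `M(x) = ∑_e ∑'_ν λ_ν g([e, ν])`.
* (6.4): `L(x) ≤ log(x/U) (log log(x/U) - log log U + 2|K₉|(log U)^{-10}) ≤ K_L log log x` by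
  (1.9) at `U` and `x/U` (`sum_Ioc_prime_density_mul_log_le`, `fiS1_L_final`;
  `K_L = 4 log 64 + 8α + 8|K₉|`).
* (6.5): `g([e, ν]) = g(e) g(ν/(ν, e))` (`map_lcm_eq_mul_prodPrimeFactors_ite`), positivity
  `∑_ν λ_ν g(ν/(ν, e)) ≥ 0`, Rankin's factor `(R/e)^ε` with `R = 64δ²`, `ε = 1/log x`, extension of
  `e` to all divisors of `P(z₁)` (`R < z₁`), the Euler product
  `∑_{e ∣ P(z₁)} e^{-ε} g(e/(e,ν)) = ∏_{p<z₁} (1 + p^{-ε} g(p/(p,ν)))`, FI's `h` and `w_ε = g h`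
  (`map_mul_prod_eq_prod_mul_prod_fiSieveDensity`), the sieve bound, and
  `∏ (1 + g p^{-ε})(1 - w_ε) = ∏ (1 - g)` give `M(x) ≤ C R^ε ∏_{p < z₁} (1 - g(p))`
  (`sum_sum_lcm_le_of_sieve`); then `∏_{p<z₁} (1 - g(p)) ≤ e^{C₀}/log(z₁/2)` by (1.9)
  (`prod_one_sub_density_le`, `C₀ = -c₉ + |K₉|(log 2)^{-10}`) and `R^ε ≤ e`, so
  `M(x) ≤ K_M / log x`, `K_M = 2 C e^{1 + C₀}/θ₁` (`fiS1_M_final`).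
* Total: `|S₁(x; y, z)| ≤ (K_L K_M + |K_R|) A(x) log log x / log x` (`fiS1_combine`,
  `fi_asp_S1_estimate_holds`). The parameter inequalities for large `x` (`U ≥ 2`, `x^{θ/2} < U`,
  `64δ² < x^{θ₁}`, `512 δ³ x^{1/2+θ/2} ≤ x^{2/3} < D(x)`, …) are `fiS1_param_bounds`, fed by
  `(log x)^r = o(x^s)` (`eventually_log_rpow_le_mul_rpow`).

## Faithfulness notes

* This is a proof of the tree's (accepted) statement `fi_asp_S1_estimate`, itself FI (6.6) in the
  regime of `fi_asymptotic_sieve_primes_loglog`; nothing is restated. FI choose `ε = (log Δ)⁻¹`;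
  here `ε = (log x)⁻¹` (any `ε ≍ 1/log x` works, the factor `R^ε = (64δ²)^ε` staying bounded), and
  the sieve bound is used at the sifting range `z₁ = x^{θ₁}` exactly as the fact's hypothesis offers
  it. The crude divisor count `τ(m)² ≤ τ₅(m)` replaces FI's implicit appeal to (R′).
* The local notation `gcp[g, e]` (for `ArithmeticFunction.prodPrimeFactors (p ↦ if p ∣ e then 1
  else g p)`, FI's `g(ν/(ν, e))` on squarefree `ν`) is notation only; no definition is introduced.

## Mathlib search

Used: `ArithmeticFunction` (`coe_mul_zeta_apply`, `mul_apply`, `vonMangoldt_sum`,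
`vonMangoldt_eq_zero_iff`, `prodPrimeFactors`,
`IsMultiplicative.prodPrimeFactors_one_add_of_squarefree`,
`IsMultiplicative.prod_primeFactors`, `abs_moebius_le_one`), `Nat.factorization_lcm`,
`Finsupp.support_sup`, `Nat.lcm_dvd_iff`, `Nat.squarefree_mul_iff`, `Finset.sum_sigma'`,
`Finset.sum_image`, `Finset.sum_fiberwise_of_maps_to`, `Finset.prod_sdiff`, `Real.finsetProd_rpow`,
`isLittleO_log_rpow_rpow_atTop`, `Real.add_one_le_exp`, `Real.log_le_sub_one_of_pos`. The tree's
`divisorCountK_apply_of_squarefree`, `card_divisors_of_squarefree` give `τ(m) = 2^{ω(m)}`,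
`τ₅(m) = 5^{ω(m)}`; the two-line facts `τ(m)² ≤ τ₅(m)` and "`A_d(x) = 0` for non-squarefree `d`"
are proved inline where used (they are `card_divisors_sq_le_divisorCountK_five` and
`FIAsymptoticSieveHypotheses.congrSum_eq_zero_of_not_squarefree` of the sibling file `…Tyz`, which
this file does not import). The `lcm`/`gcd` bookkeeping here is phrased through `prodPrimeFactors`
(FI's `g(ν/(ν, e))` as a multiplicative function of `ν`, as the positivity lemma
`IsUpperSieveWeights.sum_mul_nonneg` requires), not through `g(m/(m, ν))` as in `…Tyz`. No form of
FI §6 exists in Mathlib or the tree (`lean search 'fiS1|Rankin|lcm.*sieve'`).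
-/

noncomputable section

open Filter Finset
open scoped ArithmeticFunction.Moebius ArithmeticFunction.vonMangoldt ArithmeticFunction.zeta
  ArithmeticFunction.omega ArithmeticFunction.sigma

namespace Literature.NumberTheory.Sieve

/-! ### Least common multiples of squarefree numbers -/

section Lcm

/-- The `lcm` of two squarefree numbers is squarefree. [folklore] -/
theorem squarefree_lcm {a b : ℕ} (ha : Squarefree a) (hb : Squarefree b) :
    Squarefree (a.lcm b) := by
  have ha0 : a ≠ 0 := ha.ne_zero
  have hb0 : b ≠ 0 := hb.ne_zero
  have hl0 : a.lcm b ≠ 0 := (Nat.lcm_pos (Nat.pos_of_ne_zero ha0) (Nat.pos_of_ne_zero hb0)).ne'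
  rw [Nat.squarefree_iff_factorization_le_one hl0]
  intro p
  rw [Nat.factorization_lcm ha0 hb0, Finsupp.sup_apply]
  exact sup_le ((Nat.squarefree_iff_factorization_le_one ha0).mp ha p)
    ((Nat.squarefree_iff_factorization_le_one hb0).mp hb p)

/-- The prime factors of `lcm a b` are those of `a` together with those of `b`. [folklore] -/
theorem primeFactors_lcm {a b : ℕ} (ha : a ≠ 0) (hb : b ≠ 0) :
    (a.lcm b).primeFactors = a.primeFactors ∪ b.primeFactors := by
  classical
  rw [← Nat.support_factorization, Nat.factorization_lcm ha hb, Finsupp.support_sup,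
    Nat.support_factorization, Nat.support_factorization]

/-- `lcm a b ≤ a b`. [folklore] -/
theorem lcm_le_mul {a b : ℕ} (ha : 0 < a) (hb : 0 < b) : a.lcm b ≤ a * b :=
  Nat.le_of_dvd (Nat.mul_pos ha hb) (Nat.lcm_dvd_mul a b)

/-- For a prime `c` not dividing `ν`: `lcm (c e) ν = c · lcm e ν`. [folklore] -/
theorem lcm_prime_mul_left {c e ν : ℕ} (hc : c.Prime) (hcν : ¬c ∣ ν) :
    (c * e).lcm ν = c * e.lcm ν := by
  have hcop : c.Coprime ν := (Nat.Prime.coprime_iff_not_dvd hc).mpr hcν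
  unfold Nat.lcm
  rw [hcop.gcd_mul_left_cancel e, mul_assoc, Nat.mul_div_assoc c]
  exact Dvd.dvd.mul_right (Nat.gcd_dvd_left e ν) ν

/-- A prime `c` dividing neither `e` nor `ν` is coprime to `lcm e ν`. [folklore] -/
theorem coprime_lcm_of_not_dvd {c e ν : ℕ} (hc : c.Prime) (hce : ¬c ∣ e) (hcν : ¬c ∣ ν) :
    c.Coprime (e.lcm ν) := by
  rw [Nat.Prime.coprime_iff_not_dvd hc]
  intro h
  rcases (Nat.Prime.dvd_mul hc).mp (h.trans (Nat.lcm_dvd_mul e ν)) with h' | h'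
  · exact hce h'
  · exact hcν h'

/-- A squarefree number all of whose prime factors are `< z` divides `P(z)`. [folklore] -/
theorem dvd_primesProdBelow_of_squarefree {e : ℕ} (he : Squarefree e) {z : ℝ}
    (h : ∀ p ∈ e.primeFactors, (p : ℝ) < z) : e ∣ primesProdBelow z := by
  rw [← Nat.prod_primeFactors_of_squarefree he, primesProdBelow]
  refine Finset.prod_dvd_prod_of_subset _ _ (fun p => p) fun p hp => ?_
  rw [Nat.mem_primesBelow]
  exact ⟨Nat.lt_ceil.mpr (h p hp), Nat.prime_of_mem_primeFactors hp⟩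

end Lcm

/-! ### The crude bound for `Λ₁(n; y, z)` (FI §6, "By dropping `μ(b)`") -/

section Conv

/-- For `1 ≤ n ≤ x`, `u, v > 0`:
`|∑_{bce = n, b > u, c > v} μ(b) Λ(c)| ≤ ∑_{v < c ≤ x/u, 1 ≤ e ≤ x/(uv), ce ∣ n} Λ(c)`
(drop `μ(b)` and forget `b = n/(ce)`; FI §6, second display on p. 1055).
[cite: FriedlanderIwaniecASP1998, §6 p. 1055] -/
theorem abs_truncGT_moebius_mul_truncGT_vonMangoldt_mul_zeta_le {u v x : ℝ} (hu : 0 < u)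
    (hv : 0 < v) {n : ℕ} (hn : n ≠ 0) (hnx : (n : ℝ) ≤ x) :
    |(truncGT (μ : ArithmeticFunction ℝ) u * truncGT Λ v * ζ) n| ≤
      ∑ q ∈ (Ioc ⌊v⌋₊ ⌊x / u⌋₊ ×ˢ Icc 1 ⌊x / (u * v)⌋₊).filter
          (fun q : ℕ × ℕ => q.1 * q.2 ∣ n), Λ q.1 := by
  classical
  rw [ArithmeticFunction.coe_mul_zeta_apply]
  simp only [ArithmeticFunction.mul_apply]
  -- the summand after dropping `μ(b)`
  set h : ℕ × ℕ → ℝ := fun p => if u < (p.1 : ℝ) ∧ v < (p.2 : ℝ) then Λ p.2 else 0 with hh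
  have hterm : ∀ p : ℕ × ℕ,
      |truncGT (μ : ArithmeticFunction ℝ) u p.1 * truncGT Λ v p.2| ≤ h p := by
    intro p
    simp only [hh, truncGT_apply, ArithmeticFunction.intCoe_apply]
    by_cases h1 : u < (p.1 : ℝ)
    · by_cases h2 : v < (p.2 : ℝ)
      · rw [if_pos h1, if_pos h2, if_pos ⟨h1, h2⟩, abs_mul,
          abs_of_nonneg ArithmeticFunction.vonMangoldt_nonneg]
        refine mul_le_of_le_one_left ArithmeticFunction.vonMangoldt_nonneg ?_
        exact_mod_cast ArithmeticFunction.abs_moebius_le_one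
      · rw [if_neg h2, mul_zero, abs_zero, if_neg (fun h' => h2 h'.2)]
    · rw [if_neg h1, zero_mul, abs_zero, if_neg (fun h' => h1 h'.1)]
  -- step 1: triangle inequality and `sum_sigma'`
  set S' := (n.divisors.sigma fun m => m.divisorsAntidiagonal).filter
      (fun s => u < (s.2.1 : ℝ) ∧ v < (s.2.2 : ℝ)) with hS'
  have step1 : |∑ m ∈ n.divisors, ∑ p ∈ m.divisorsAntidiagonal,
        truncGT (μ : ArithmeticFunction ℝ) u p.1 * truncGT Λ v p.2| ≤ ∑ s ∈ S', Λ s.2.2 := by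
    refine (Finset.abs_sum_le_sum_abs _ _).trans ?_
    refine (Finset.sum_le_sum fun m _ => Finset.abs_sum_le_sum_abs _ _).trans ?_
    refine (Finset.sum_le_sum fun m _ => Finset.sum_le_sum fun p _ => hterm p).trans ?_
    rw [Finset.sum_sigma', hS', Finset.sum_filter]
  refine step1.trans ?_
  -- step 2: the injection `(m, (b, c)) ↦ (c, n/m)`
  set φ : (Σ _ : ℕ, ℕ × ℕ) → ℕ × ℕ := fun s => (s.2.2, n / s.1) with hφ
  have hmem : ∀ s ∈ S', s.1 ∣ n ∧ s.2.1 * s.2.2 = s.1 ∧ s.1 ≠ 0 ∧ u < (s.2.1 : ℝ) ∧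
      v < (s.2.2 : ℝ) := by
    intro s hs
    simp only [hS', Finset.mem_filter, Finset.mem_sigma, Nat.mem_divisors,
      Nat.mem_divisorsAntidiagonal] at hs
    exact ⟨hs.1.1.1, hs.1.2.1, hs.1.2.2, hs.2.1, hs.2.2⟩
  have hinj : Set.InjOn φ S' := by
    intro s hs s' hs' heq
    obtain ⟨hd, hbc, -, -, hvc⟩ := hmem s hs
    obtain ⟨hd', hbc', -, -, -⟩ := hmem s' hs'
    simp only [hφ, Prod.mk.injEq] at heq
    obtain ⟨hc, hnm⟩ := heq
    have hm : s.1 = s'.1 := by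
      rw [← Nat.div_div_self hd hn, ← Nat.div_div_self hd' hn, hnm]
    have hc0 : 0 < s.2.2 := by
      have : (0 : ℝ) < s.2.2 := hv.trans hvc
      exact_mod_cast this
    have hb : s.2.1 = s'.2.1 := by
      have : s.2.1 * s.2.2 = s'.2.1 * s.2.2 := by rw [hbc, hm, ← hbc', hc]
      exact Nat.eq_of_mul_eq_mul_right hc0 this
    exact Sigma.ext hm (heq_of_eq (Prod.ext hb hc))
  have himage : S'.image φ ⊆ (Ioc ⌊v⌋₊ ⌊x / u⌋₊ ×ˢ Icc 1 ⌊x / (u * v)⌋₊).filter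
      (fun q : ℕ × ℕ => q.1 * q.2 ∣ n) := by
    intro q hq
    obtain ⟨s, hs, rfl⟩ := Finset.mem_image.mp hq
    obtain ⟨hd, hbc, hm0, hub, hvc⟩ := hmem s hs
    have hmn : s.1 ≤ n := Nat.le_of_dvd (Nat.pos_of_ne_zero hn) hd
    have hmnR : (s.1 : ℝ) ≤ x := le_trans (by exact_mod_cast hmn) hnx
    have hb0R : (0 : ℝ) < s.2.1 := hu.trans hub
    have hbcR : (s.2.1 : ℝ) * s.2.2 = s.1 := by exact_mod_cast hbc
    have hq0 : 0 < n / s.1 := Nat.div_pos hmn (Nat.pos_of_ne_zero hm0)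
    have hqm : ((n / s.1 : ℕ) : ℝ) * s.1 = n := by exact_mod_cast Nat.div_mul_cancel hd
    simp only [hφ, Finset.mem_filter, Finset.mem_product, Finset.mem_Ioc, Finset.mem_Icc]
    refine ⟨⟨⟨(Nat.floor_lt hv.le).mpr hvc, Nat.le_floor ?_⟩, hq0, Nat.le_floor ?_⟩, ?_⟩
    · rw [le_div_iff₀ hu]
      calc (s.2.2 : ℝ) * u ≤ s.2.2 * s.2.1 := by gcongr
        _ = s.1 := by rw [mul_comm, hbcR]
        _ ≤ x := hmnR
    · rw [le_div_iff₀ (mul_pos hu hv)]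
      calc ((n / s.1 : ℕ) : ℝ) * (u * v) ≤ (n / s.1 : ℕ) * (s.2.1 * s.2.2) := by
            gcongr
        _ = n := by rw [hbcR, hqm]
        _ ≤ x := hnx
    · exact Dvd.intro_left s.2.1 (by rw [← mul_assoc, hbc]; exact Nat.mul_div_cancel' hd)
  calc ∑ s ∈ S', Λ s.2.2 = ∑ s ∈ S', (fun q : ℕ × ℕ => Λ q.1) (φ s) := rfl
    _ = ∑ q ∈ S'.image φ, Λ q.1 := (Finset.sum_image (f := fun q : ℕ × ℕ => Λ q.1) hinj).symm
    _ ≤ _ := Finset.sum_le_sum_of_subset_of_nonneg himage fun q _ _ =>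
        ArithmeticFunction.vonMangoldt_nonneg

end Conv


/-! ### Congruence sums weighted by `ρ_n` (FI §6: `∑_{cd ∣ n} ρ_n a_n = ∑_ν λ_ν A_{[cd, ν]}(x)`) -/

section RhoCongr

variable {z L : ℝ} {lam : ℕ → ℤ}

/-- `ρ_n = ∑_{ν ∣ P(z), ν ∣ n} λ_ν` for `n ≠ 0`: the weights are supported on divisors of `P(z)`.
[folklore] -/
theorem IsUpperSieveWeights.sieveRho_eq_sum_filter (hw : IsUpperSieveWeights z L lam) {n : ℕ}
    (hn : n ≠ 0) :
    (sieveRho lam n : ℝ) = ∑ ν ∈ (primesProdBelow z).divisors with ν ∣ n, (lam ν : ℝ) := by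
  classical
  rw [sieveRho, Int.cast_sum]
  have hP0 := primesProdBelow_ne_zero z
  rw [← Finset.sum_filter_of_ne (p := fun ν => ν ∈ (primesProdBelow z).divisors) (fun ν _ hν => ?_)]
  · refine Finset.sum_congr ?_ fun _ _ => rfl
    ext ν
    simp only [Finset.mem_filter, Nat.mem_divisors]
    tauto
  · have : lam ν ≠ 0 := by exact_mod_cast hν
    exact Nat.mem_divisors.mpr ⟨(hw.dvd_and_le_of_ne_zero ν this).1, hP0⟩

/-- **`∑_{n ≤ x, k ∣ n} a_n ρ_n = ∑_{ν ∣ P(z)} λ_ν A_{[k, ν]}(x)`** (expand `ρ_n = ∑_{ν ∣ n} λ_ν`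
and interchange; `k ∣ n ∧ ν ∣ n ↔ [k, ν] ∣ n`). [cite: FriedlanderIwaniecASP1998, §6 p. 1055] -/
theorem IsUpperSieveWeights.sum_filter_dvd_a_mul_sieveRho (hw : IsUpperSieveWeights z L lam)
    (A : SieveSequence) (k : ℕ) (x : ℝ) :
    ∑ n ∈ Icc 1 ⌊x⌋₊ with k ∣ n, A.a n * (sieveRho lam n : ℝ) =
      ∑ ν ∈ (primesProdBelow z).divisors, (lam ν : ℝ) * A.congrSum (k.lcm ν) x := by
  classical
  have step : ∀ n ∈ (Icc 1 ⌊x⌋₊).filter (k ∣ ·), A.a n * (sieveRho lam n : ℝ) =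
      ∑ ν ∈ (primesProdBelow z).divisors, if ν ∣ n then A.a n * (lam ν : ℝ) else 0 := by
    intro n hn
    have hn0 : n ≠ 0 := by
      have := (Finset.mem_Icc.mp (Finset.mem_filter.mp hn).1).1
      omega
    rw [hw.sieveRho_eq_sum_filter hn0, Finset.mul_sum, ← Finset.sum_filter]
  rw [Finset.sum_congr rfl step, Finset.sum_comm]
  refine Finset.sum_congr rfl fun ν _ => ?_
  rw [← Finset.sum_filter, Finset.filter_filter, SieveSequence.congrSum, Finset.mul_sum]
  have hset : (Icc 1 ⌊x⌋₊).filter (fun n => k ∣ n ∧ ν ∣ n) = (Ioc 0 ⌊x⌋₊).filter (k.lcm ν ∣ ·) := by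
    ext n
    simp only [Finset.mem_filter, Finset.mem_Icc, Finset.mem_Ioc, Nat.lcm_dvd_iff]
    omega
  rw [hset]
  refine Finset.sum_congr rfl fun n _ => mul_comm _ _

variable {A : SieveSequence}

/-- **Main term plus remainder**: for weights supported on divisors of `P(z)` and a sequence
whose congruence sums `A_d(x)` vanish for non-squarefree `d` (as under (1.16)),
`∑_{n ≤ x, k ∣ n} a_n ρ_n = A(x) ∑'_ν λ_ν g([k, ν]) + ∑'_ν λ_ν r_{[k, ν]}(x)`, the sums `∑'`
running over `ν ∣ P(z)` with `[k, ν]` squarefree (FI §6: "We insert (1.7)").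
[cite: FriedlanderIwaniecASP1998, §6 (6.3)] -/
theorem IsUpperSieveWeights.sum_filter_dvd_a_mul_sieveRho_eq_main_add_rem
    (hw : IsUpperSieveWeights z L lam) (k : ℕ) (x : ℝ)
    (h16 : ∀ d : ℕ, ¬Squarefree d → A.congrSum d x = 0) :
    ∑ n ∈ Icc 1 ⌊x⌋₊ with k ∣ n, A.a n * (sieveRho lam n : ℝ) =
      A.size x * ∑ ν ∈ (primesProdBelow z).divisors with Squarefree (k.lcm ν),
          (lam ν : ℝ) * A.density (k.lcm ν) +
        ∑ ν ∈ (primesProdBelow z).divisors with Squarefree (k.lcm ν),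
          (lam ν : ℝ) * A.remainder (k.lcm ν) x := by
  classical
  rw [hw.sum_filter_dvd_a_mul_sieveRho A k x, Finset.mul_sum, ← Finset.sum_add_distrib,
    ← Finset.sum_filter_of_ne (p := fun ν => Squarefree (k.lcm ν))]
  · refine Finset.sum_congr rfl fun ν _ => ?_
    rw [SieveSequence.remainder]
    ring
  · intro ν _ hne
    by_contra hsq
    exact hne (by rw [h16 _ hsq, mul_zero])

end RhoCongr

/-! ### The remainder terms (FI §6: "estimate the resulting remainder by (R′)") -/

section Remainder

/-- The fibre count: if every `((c, e), ν) ∈ I` has `[ce, ν] = m ≠ 0`, then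
`∑_I Λ(c) ≤ log m · τ(m)²` (`c, e, ν` are divisors of `m` and `∑_{c ∣ m} Λ(c) = log m`).
[folklore] -/
theorem sum_vonMangoldt_le_of_lcm_eq {m : ℕ} (hm : m ≠ 0) (I : Finset ((ℕ × ℕ) × ℕ))
    (hI : ∀ i ∈ I, (i.1.1 * i.1.2).lcm i.2 = m) :
    ∑ i ∈ I, Λ i.1.1 ≤ Real.log m * (m.divisors.card : ℝ) ^ 2 := by
  classical
  have hsub : I ⊆ (m.divisors ×ˢ m.divisors) ×ˢ m.divisors := by
    intro i hi
    have h := hI i hi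
    have hce : i.1.1 * i.1.2 ∣ m := h ▸ Nat.dvd_lcm_left _ _
    simp only [Finset.mem_product, Nat.mem_divisors]
    exact ⟨⟨⟨(dvd_mul_right _ _).trans hce, hm⟩, (dvd_mul_left _ _).trans hce, hm⟩,
      h ▸ Nat.dvd_lcm_right _ _, hm⟩
  refine (Finset.sum_le_sum_of_subset_of_nonneg hsub fun _ _ _ =>
    ArithmeticFunction.vonMangoldt_nonneg).trans ?_
  rw [Finset.sum_product, Finset.sum_product]
  simp only [Finset.sum_const, nsmul_eq_mul]
  rw [← Finset.mul_sum, ← Finset.mul_sum, ArithmeticFunction.vonMangoldt_sum]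
  exact le_of_eq (by ring)

variable {A : SieveSequence} {z L : ℝ} {lam : ℕ → ℤ}

/-- **The remainder after inserting (1.7)** is controlled by (R′): if `|λ| ≤ 1`, `λ_ν = 0` for
`ν > L`, and `c e ν ≤ D_x ≤ x` for all `(c, e) ∈ Q`, `ν ≤ L`, then
`|∑_{(c,e) ∈ Q} Λ(c) ∑'_ν λ_ν r_{[ce, ν]}(x)| ≤ log x · ∑_{m ≤ D_x sqfree} τ₅(m) |r_m(x)|`
(each squarefree `m` arises from at most `τ(m)²` pairs `(e, ν)` for each prime `c ∣ m`, with
weight `∑_{c ∣ m} Λ(c) = log m ≤ log x`, and `τ(m)² ≤ τ₅(m)`).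
[cite: FriedlanderIwaniecASP1998, §6 (6.3)] -/
theorem abs_sum_vonMangoldt_mul_rem_le (hw : IsUpperSieveWeights z L lam) (Q : Finset (ℕ × ℕ))
    {x Dx : ℝ} (hx : 1 ≤ x) (hDx0 : 0 ≤ Dx) (hDx : Dx ≤ x) (hQ0 : ∀ q ∈ Q, q.1 * q.2 ≠ 0)
    (hQ : ∀ q ∈ Q, ∀ ν : ℕ, (ν : ℝ) ≤ L → ((q.1 * q.2 : ℕ) : ℝ) * ν ≤ Dx) :
    |∑ q ∈ Q, Λ q.1 * ∑ ν ∈ (primesProdBelow z).divisors with Squarefree ((q.1 * q.2).lcm ν),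
        (lam ν : ℝ) * A.remainder ((q.1 * q.2).lcm ν) x| ≤
      Real.log x * ∑ m ∈ (Icc 1 ⌊Dx⌋₊).filter Squarefree,
        (divisorCountK 5 m : ℝ) * |A.remainder m x| := by
  classical
  set Pd := (primesProdBelow z).divisors with hPd
  set PdL := Pd.filter (fun ν : ℕ => (ν : ℝ) ≤ L) with hPdL
  -- Step 1: restrict to `ν ≤ L` and take absolute values
  have inner_le : ∀ q ∈ Q,
      |∑ ν ∈ Pd with Squarefree ((q.1 * q.2).lcm ν),
          (lam ν : ℝ) * A.remainder ((q.1 * q.2).lcm ν) x| ≤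
        ∑ ν ∈ PdL with Squarefree ((q.1 * q.2).lcm ν), |A.remainder ((q.1 * q.2).lcm ν) x| := by
    intro q _
    have hrestrict : ∑ ν ∈ Pd with Squarefree ((q.1 * q.2).lcm ν),
        (lam ν : ℝ) * A.remainder ((q.1 * q.2).lcm ν) x =
        ∑ ν ∈ PdL with Squarefree ((q.1 * q.2).lcm ν),
          (lam ν : ℝ) * A.remainder ((q.1 * q.2).lcm ν) x := by
      have hset : PdL.filter (fun ν => Squarefree ((q.1 * q.2).lcm ν)) =
          (Pd.filter (fun ν => Squarefree ((q.1 * q.2).lcm ν))).filter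
            (fun ν : ℕ => (ν : ℝ) ≤ L) := by
        rw [hPdL, Finset.filter_filter, Finset.filter_filter]
        exact Finset.filter_congr fun ν _ => and_comm
      rw [hset]
      symm
      apply Finset.sum_filter_of_ne
      intro ν _ hne
      by_contra hνL
      have : lam ν = 0 := hw.eq_zero_of_lt (not_le.mp hνL)
      exact hne (by rw [this, Int.cast_zero, zero_mul])
    rw [hrestrict]
    refine (Finset.abs_sum_le_sum_abs _ _).trans (Finset.sum_le_sum fun ν _ => ?_)
    rw [abs_mul]
    refine mul_le_of_le_one_left (abs_nonneg _) ?_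
    exact_mod_cast hw.abs_le_one ν
  -- Step 2: combine into one sum over `I`
  set I := (Q ×ˢ PdL).filter (fun i : (ℕ × ℕ) × ℕ => Squarefree ((i.1.1 * i.1.2).lcm i.2)) with hI
  have step2 : |∑ q ∈ Q, Λ q.1 * ∑ ν ∈ Pd with Squarefree ((q.1 * q.2).lcm ν),
        (lam ν : ℝ) * A.remainder ((q.1 * q.2).lcm ν) x| ≤
      ∑ i ∈ I, Λ i.1.1 * |A.remainder ((i.1.1 * i.1.2).lcm i.2) x| := by
    refine (Finset.abs_sum_le_sum_abs _ _).trans ?_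
    have : ∀ q ∈ Q, |Λ q.1 * ∑ ν ∈ Pd with Squarefree ((q.1 * q.2).lcm ν),
        (lam ν : ℝ) * A.remainder ((q.1 * q.2).lcm ν) x| ≤
        ∑ ν ∈ PdL, if Squarefree ((q.1 * q.2).lcm ν) then
          Λ q.1 * |A.remainder ((q.1 * q.2).lcm ν) x| else 0 := by
      intro q hq
      rw [abs_mul, abs_of_nonneg ArithmeticFunction.vonMangoldt_nonneg, ← Finset.sum_filter,
        ← Finset.mul_sum]
      exact mul_le_mul_of_nonneg_left (inner_le q hq) ArithmeticFunction.vonMangoldt_nonneg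
    refine (Finset.sum_le_sum this).trans (le_of_eq ?_)
    rw [hI, Finset.sum_filter, Finset.sum_product]
  refine step2.trans ?_
  -- Step 3: fibre over `m = [ce, ν]`
  set M := (Icc 1 ⌊Dx⌋₊).filter Squarefree with hM
  set φ : (ℕ × ℕ) × ℕ → ℕ := fun i => (i.1.1 * i.1.2).lcm i.2 with hφ
  have hmaps : ∀ i ∈ I, φ i ∈ M := by
    intro i hi
    simp only [hI, hPdL, Finset.mem_filter, Finset.mem_product] at hi
    obtain ⟨⟨hq, hνP, hνL⟩, hsq⟩ := hi
    have hν0 : i.2 ≠ 0 := Nat.pos_of_mem_divisors hνP |>.ne'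
    have hk0 := hQ0 i.1 hq
    simp only [hM, hφ, Finset.mem_filter, Finset.mem_Icc]
    refine ⟨⟨Nat.lcm_pos (Nat.pos_of_ne_zero hk0) (Nat.pos_of_ne_zero hν0), Nat.le_floor ?_⟩, hsq⟩
    calc (((i.1.1 * i.1.2).lcm i.2 : ℕ) : ℝ) ≤ ((i.1.1 * i.1.2 * i.2 : ℕ) : ℝ) := by
          exact_mod_cast lcm_le_mul (Nat.pos_of_ne_zero hk0) (Nat.pos_of_ne_zero hν0)
      _ = ((i.1.1 * i.1.2 : ℕ) : ℝ) * i.2 := by push_cast; ring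
      _ ≤ Dx := hQ i.1 hq i.2 hνL
  rw [← Finset.sum_fiberwise_of_maps_to hmaps, Finset.mul_sum]
  refine Finset.sum_le_sum fun m hm => ?_
  have hmM := hm
  simp only [hM, Finset.mem_filter, Finset.mem_Icc] at hmM
  obtain ⟨⟨hm1, hmD⟩, hmsq⟩ := hmM
  have hm0 : m ≠ 0 := by omega
  have hfib : ∑ i ∈ I with φ i = m, Λ i.1.1 * |A.remainder ((i.1.1 * i.1.2).lcm i.2) x| =
      (∑ i ∈ I with φ i = m, Λ i.1.1) * |A.remainder m x| := by
    rw [Finset.sum_mul]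
    refine Finset.sum_congr rfl fun i hi => ?_
    have := (Finset.mem_filter.mp hi).2
    simp only [hφ] at this
    rw [this]
  rw [hfib]
  have hcount : ∑ i ∈ I with φ i = m, Λ i.1.1 ≤ Real.log m * (m.divisors.card : ℝ) ^ 2 :=
    sum_vonMangoldt_le_of_lcm_eq hm0 _ fun i hi => (Finset.mem_filter.mp hi).2
  have hlogm : Real.log m ≤ Real.log x := by
    refine Real.log_le_log (by exact_mod_cast Nat.pos_of_ne_zero hm0) ?_
    exact ((Nat.le_floor_iff hDx0).mp hmD).trans hDx
  -- `τ(m)² ≤ τ₅(m)` for squarefree `m` (`4^ω ≤ 5^ω`)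
  have hτ : ((m.divisors.card : ℝ)) ^ 2 ≤ (divisorCountK 5 m : ℝ) := by
    rw [card_divisors_of_squarefree hmsq, divisorCountK_apply_of_squarefree 5 hmsq,
      ← card_primeFactors_eq_cardDistinctFactors]
    push_cast
    rw [← pow_mul, mul_comm, pow_mul]
    norm_num
    exact pow_le_pow_left₀ (by norm_num) (by norm_num) _
  calc (∑ i ∈ I with φ i = m, Λ i.1.1) * |A.remainder m x|
      ≤ (Real.log m * (m.divisors.card : ℝ) ^ 2) * |A.remainder m x| :=
        mul_le_mul_of_nonneg_right hcount (abs_nonneg _)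
    _ ≤ (Real.log x * (divisorCountK 5 m : ℝ)) * |A.remainder m x| := by
        refine mul_le_mul_of_nonneg_right ?_ (abs_nonneg _)
        exact mul_le_mul hlogm hτ (by positivity)
          (Real.log_nonneg hx)
    _ = Real.log x * ((divisorCountK 5 m : ℝ) * |A.remainder m x|) := by ring

end Remainder


/-! ### The main terms: `L(x) M(x)` (FI §6, (6.3)–(6.5)) -/

/-- `gcp[g, e]` denotes the multiplicative function `ν ↦ ∏_{p ∣ ν, p ∤ e} g(p)` (FI §6 p. 1055:
`g(ν/(ν, d))` in "we write `g([d, ν]) = g(d) g(ν/(ν, d))`"; the two agree on squarefree `ν`, which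
is all that is used), realised as `ArithmeticFunction.prodPrimeFactors`. -/
local notation "gcp[" g ", " e "]" =>
  ArithmeticFunction.prodPrimeFactors (fun p => ite (p ∣ e) (1 : ℝ) (g p))

section MainTerm

open ArithmeticFunction

variable {g : ArithmeticFunction ℝ}

/-- Value at a prime: `1` if `p ∣ e`, else `g(p)`. [folklore] -/
theorem prodPrimeFactors_ite_apply_prime (g : ArithmeticFunction ℝ) (e : ℕ) {p : ℕ} (hp : p.Prime) :
    gcp[g, e] p = if p ∣ e then 1 else g p := by
  rw [ArithmeticFunction.prodPrimeFactors_apply hp.ne_zero, hp.primeFactors, Finset.prod_singleton]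

/-- Value at a squarefree `ν`: `∏_{p ∣ ν, p ∤ e} g(p)`. [folklore] -/
theorem prodPrimeFactors_ite_apply_of_ne_zero (g : ArithmeticFunction ℝ) (e : ℕ) {ν : ℕ}
    (hν : ν ≠ 0) :
    gcp[g, e] ν = ∏ p ∈ ν.primeFactors with ¬p ∣ e, g p := by
  classical
  rw [ArithmeticFunction.prodPrimeFactors_apply hν, Finset.prod_ite, Finset.prod_const_one, one_mul]

/-- **`g([e, ν]) = g(e) g(ν/(ν, e))`** for squarefree `e, ν` and multiplicative `g`
(FI §6 p. 1055). [cite: FriedlanderIwaniecASP1998, §6 p. 1055] -/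
theorem map_lcm_eq_mul_prodPrimeFactors_ite (hg : g.IsMultiplicative) {e ν : ℕ}
    (he : Squarefree e) (hν : Squarefree ν) : g (e.lcm ν) = g e * gcp[g, e] ν := by
  classical
  have he0 := he.ne_zero
  have hν0 := hν.ne_zero
  rw [← hg.prod_primeFactors (squarefree_lcm he hν), primeFactors_lcm he0 hν0,
    ← Finset.prod_sdiff
      (Finset.subset_union_left : e.primeFactors ⊆ e.primeFactors ∪ ν.primeFactors),
    Finset.union_sdiff_left, hg.prod_primeFactors he, prodPrimeFactors_ite_apply_of_ne_zero g e hν0,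
    mul_comm]
  congr 1
  refine Finset.prod_congr ?_ fun _ _ => rfl
  ext p
  simp only [Finset.mem_sdiff, Finset.mem_filter, Nat.mem_primeFactors]
  constructor
  · rintro ⟨hpν, hpe⟩
    exact ⟨hpν, fun h => hpe ⟨hpν.1, h, he0⟩⟩
  · rintro ⟨hpν, hpe⟩
    exact ⟨hpν, fun h => hpe h.2.1⟩

/-- Symmetry `g(e) g(ν/(ν,e)) = g(ν) g(e/(e,ν))` (both equal `g([e, ν])`). [folklore] -/
theorem map_mul_prodPrimeFactors_ite_comm (hg : g.IsMultiplicative) {e ν : ℕ} (he : Squarefree e)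
    (hν : Squarefree ν) : g e * gcp[g, e] ν = g ν * gcp[g, ν] e := by
  rw [← map_lcm_eq_mul_prodPrimeFactors_ite hg he hν,
    ← map_lcm_eq_mul_prodPrimeFactors_ite hg hν he, Nat.lcm_comm]

/-- Pulling out a large prime: for a prime `c ≥ z` with `c ∤ e`,
`∑'_{ν ∣ P(z)} λ_ν g([ce, ν]) = g(c) ∑'_{ν ∣ P(z)} λ_ν g([e, ν])` (the `'` denoting the restriction
to squarefree `[·, ν]`; FI: `g([cd, ν]) = g(c) g([d, ν])` since `c` is a prime exceeding `d` and
`ν`).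
[cite: FriedlanderIwaniecASP1998, §6 (6.3)] -/
theorem sum_lcm_prime_mul_eq (hg : g.IsMultiplicative) {z : ℝ} {c e : ℕ} (hc : c.Prime)
    (hcz : z ≤ c) (hce : ¬c ∣ e) (lam : ℕ → ℤ) :
    ∑ ν ∈ (primesProdBelow z).divisors with Squarefree ((c * e).lcm ν),
        (lam ν : ℝ) * g ((c * e).lcm ν) =
      g c * ∑ ν ∈ (primesProdBelow z).divisors with Squarefree (e.lcm ν),
        (lam ν : ℝ) * g (e.lcm ν) := by
  have hcν : ∀ ν ∈ (primesProdBelow z).divisors, ¬c ∣ ν := fun ν hν hcν =>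
    absurd ((dvd_primesProdBelow_iff hc z).mp (hcν.trans (Nat.dvd_of_mem_divisors hν)))
      (not_lt.mpr hcz)
  rw [Finset.mul_sum]
  have hfilt : (primesProdBelow z).divisors.filter (fun ν => Squarefree ((c * e).lcm ν)) =
      (primesProdBelow z).divisors.filter (fun ν => Squarefree (e.lcm ν)) := by
    refine Finset.filter_congr fun ν hν => ?_
    rw [lcm_prime_mul_left hc (hcν ν hν), Nat.squarefree_mul_iff]
    constructor
    · exact fun h => h.2.2
    · exact fun h => ⟨coprime_lcm_of_not_dvd hc hce (hcν ν hν), hc.prime.squarefree, h⟩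
  rw [hfilt]
  refine Finset.sum_congr rfl fun ν hν => ?_
  have hν' := (Finset.mem_filter.mp hν).1
  rw [lcm_prime_mul_left hc (hcν ν hν'),
    hg.map_mul_of_coprime (coprime_lcm_of_not_dvd hc hce (hcν ν hν'))]
  ring

variable {z L : ℝ} {lam : ℕ → ℤ}

/-- Positivity (FI p. 1055: "`∑_ν λ_ν g(ν/(ν, d)) ≥ 0` … a property of any upper-bound sieve"),
from `IsUpperSieveWeights.sum_mul_nonneg`. [cite: FriedlanderIwaniecASP1998, §6 p. 1055] -/
theorem IsUpperSieveWeights.sum_mul_prodPrimeFactors_ite_nonneg (hw : IsUpperSieveWeights z L lam)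
    (h18 : ∀ p : ℕ, p.Prime → 0 ≤ g p ∧ g p < 1) (e : ℕ) :
    0 ≤ ∑ ν ∈ (primesProdBelow z).divisors, (lam ν : ℝ) * gcp[g, e] ν := by
  refine hw.sum_mul_nonneg (ArithmeticFunction.IsMultiplicative.prodPrimeFactors _)
    (fun p hp _ => ?_)
    fun p hp _ => ?_
  · rw [prodPrimeFactors_ite_apply_prime g e hp]
    split_ifs
    · exact zero_le_one
    · exact (h18 p hp).1
  · rw [prodPrimeFactors_ite_apply_prime g e hp]
    split_ifs
    · exact le_rfl
    · exact (h18 p hp).2.le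

/-- The Euler product behind Rankin's trick (FI p. 1055, display before "where `h(ν)` is"):
`∑_{e ∣ P(z)} e^{-ε} g(e/(e, ν)) = ∏_{p < z} (1 + p^{-ε} g(p/(p, ν)))`.
[cite: FriedlanderIwaniecASP1998, §6 p. 1055] -/
theorem sum_divisors_rpow_neg_mul_prodPrimeFactors_ite (g : ArithmeticFunction ℝ) (ν : ℕ)
    (ε z : ℝ) :
    ∑ e ∈ (primesProdBelow z).divisors, (e : ℝ) ^ (-ε) * gcp[g, ν] e =
      ∏ p ∈ Nat.primesBelow ⌈z⌉₊, (1 + (p : ℝ) ^ (-ε) * gcp[g, ν] p) := by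
  classical
  set F : ArithmeticFunction ℝ :=
    ArithmeticFunction.prodPrimeFactors fun p => (p : ℝ) ^ (-ε) * (if p ∣ ν then 1 else g p) with hF
  have hFmult : F.IsMultiplicative := ArithmeticFunction.IsMultiplicative.prodPrimeFactors _
  have hPsq := squarefree_primesProdBelow z
  have hFe : ∀ e : ℕ, Squarefree e → F e = (e : ℝ) ^ (-ε) * gcp[g, ν] e := by
    intro e he
    have he0 := he.ne_zero
    rw [hF, ArithmeticFunction.prodPrimeFactors_apply he0, Finset.prod_mul_distrib,
      Real.finsetProd_rpow _ _ (fun p _ => Nat.cast_nonneg p), ← Nat.cast_prod,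
      Nat.prod_primeFactors_of_squarefree he, ArithmeticFunction.prodPrimeFactors_apply he0]
  have hFp : ∀ p : ℕ, p.Prime → F p = (p : ℝ) ^ (-ε) * gcp[g, ν] p := fun p hp =>
    hFe p hp.prime.squarefree
  calc ∑ e ∈ (primesProdBelow z).divisors, (e : ℝ) ^ (-ε) * gcp[g, ν] e
      = ∑ e ∈ (primesProdBelow z).divisors, F e :=
        Finset.sum_congr rfl fun e he =>
          (hFe e (hPsq.squarefree_of_dvd (Nat.dvd_of_mem_divisors he))).symm
    _ = ∏ p ∈ (primesProdBelow z).primeFactors, (1 + F p) :=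
        (hFmult.prodPrimeFactors_one_add_of_squarefree hPsq).symm
    _ = ∏ p ∈ Nat.primesBelow ⌈z⌉₊, (1 + (p : ℝ) ^ (-ε) * gcp[g, ν] p) := by
        rw [primeFactors_primesProdBelow]
        exact Finset.prod_congr rfl fun p hp => by rw [hFp p (Nat.prime_of_mem_primesBelow hp)]

/-- Introducing FI's `h`: for `ν ∣ P(z)`,
`g(ν) ∏_{p < z} (1 + p^{-ε} g(p/(p, ν))) = ∏_{p < z} (1 + g(p) p^{-ε}) · ∏_{p ∣ ν} w_ε(p)` with
`w_ε(p) = g(p)h(p)`, `h(p) = (1 + p^{-ε})(1 + g(p)p^{-ε})⁻¹` (FI p. 1055, last two displays).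
[cite: FriedlanderIwaniecASP1998, §6 p. 1055] -/
theorem map_mul_prod_eq_prod_mul_prod_fiSieveDensity (hg : g.IsMultiplicative)
    (h18 : ∀ p : ℕ, p.Prime → 0 ≤ g p ∧ g p < 1) {ε z : ℝ} {ν : ℕ}
    (hν : ν ∈ (primesProdBelow z).divisors) :
    g ν * ∏ p ∈ Nat.primesBelow ⌈z⌉₊, (1 + (p : ℝ) ^ (-ε) * gcp[g, ν] p) =
      (∏ p ∈ Nat.primesBelow ⌈z⌉₊, (1 + g p * (p : ℝ) ^ (-ε))) *
        ∏ p ∈ ν.primeFactors, fiSieveDensity g ε p := by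
  classical
  have hP0 := primesProdBelow_ne_zero z
  have hνdvd := Nat.dvd_of_mem_divisors hν
  have hνsq : Squarefree ν := (squarefree_primesProdBelow z).squarefree_of_dvd hνdvd
  have hν0 : ν ≠ 0 := hνsq.ne_zero
  have hN : ν.primeFactors ⊆ Nat.primesBelow ⌈z⌉₊ := by
    rw [← primeFactors_primesProdBelow]
    exact Nat.primeFactors_mono hνdvd hP0
  set Pz := Nat.primesBelow ⌈z⌉₊ with hPz
  have hpos : ∀ p ∈ Pz, 0 < 1 + g p * (p : ℝ) ^ (-ε) := fun p hp =>
    add_pos_of_pos_of_nonneg one_pos (mul_nonneg (h18 p (Nat.prime_of_mem_primesBelow hp)).1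
      (Real.rpow_nonneg (Nat.cast_nonneg p) _))
  -- split the products at `ν.primeFactors`
  rw [← Finset.prod_sdiff hN, ← Finset.prod_sdiff hN, ← hg.prod_primeFactors hνsq]
  have hA : ∏ p ∈ Pz \ ν.primeFactors, (1 + (p : ℝ) ^ (-ε) * gcp[g, ν] p) =
      ∏ p ∈ Pz \ ν.primeFactors, (1 + g p * (p : ℝ) ^ (-ε)) := by
    refine Finset.prod_congr rfl fun p hp => ?_
    obtain ⟨hp1, hp2⟩ := Finset.mem_sdiff.mp hp
    have hpp := Nat.prime_of_mem_primesBelow hp1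
    rw [prodPrimeFactors_ite_apply_prime g ν hpp, if_neg, mul_comm]
    exact fun h => hp2 (Nat.mem_primeFactors.mpr ⟨hpp, h, hν0⟩)
  have hB : ∏ p ∈ ν.primeFactors, (1 + (p : ℝ) ^ (-ε) * gcp[g, ν] p) =
      ∏ p ∈ ν.primeFactors, (1 + (p : ℝ) ^ (-ε)) := by
    refine Finset.prod_congr rfl fun p hp => ?_
    rw [prodPrimeFactors_ite_apply_prime g ν (Nat.prime_of_mem_primeFactors hp),
      if_pos (Nat.dvd_of_mem_primeFactors hp), mul_one]
  have hW : (∏ p ∈ ν.primeFactors, (1 + g p * (p : ℝ) ^ (-ε))) *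
      ∏ p ∈ ν.primeFactors, fiSieveDensity g ε p =
      (∏ p ∈ ν.primeFactors, g p) * ∏ p ∈ ν.primeFactors, (1 + (p : ℝ) ^ (-ε)) := by
    rw [← Finset.prod_mul_distrib, ← Finset.prod_mul_distrib]
    refine Finset.prod_congr rfl fun p hp => ?_
    have hp' := hpos p (hN hp)
    rw [fiSieveDensity]
    field_simp
  rw [hA, hB, mul_assoc, hW]
  ring

/-- `∏_{p<z} (1 + g(p)p^{-ε}) ∏_{p<z} (1 - w_ε(p)) = ∏_{p<z} (1 - g(p))` (FI p. 1056, first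
display: `∏ (1 - g(p)h(p)) = ∏ (1 - g(p))(1 + g(p)p^{-ε})⁻¹`).
[cite: FriedlanderIwaniecASP1998, §6 p. 1056] -/
theorem prod_mul_prod_one_sub_fiSieveDensity (h18 : ∀ p : ℕ, p.Prime → 0 ≤ g p ∧ g p < 1)
    (ε : ℝ) (N : ℕ) :
    (∏ p ∈ Nat.primesBelow N, (1 + g p * (p : ℝ) ^ (-ε))) *
        ∏ p ∈ Nat.primesBelow N, (1 - fiSieveDensity g ε p) =
      ∏ p ∈ Nat.primesBelow N, (1 - g p) := by
  rw [← Finset.prod_mul_distrib]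
  refine Finset.prod_congr rfl fun p hp => ?_
  have hpos : 0 < 1 + g p * (p : ℝ) ^ (-ε) :=
    add_pos_of_pos_of_nonneg one_pos (mul_nonneg (h18 p (Nat.prime_of_mem_primesBelow hp)).1
      (Real.rpow_nonneg (Nat.cast_nonneg p) _))
  rw [fiSieveDensity]
  field_simp
  ring

end MainTerm


section MainBound

open ArithmeticFunction

variable {g : ArithmeticFunction ℝ} {z L : ℝ} {lam : ℕ → ℤ}

/-- **Rankin's trick and the sieve bound for `M(x)` (FI (6.5))**: for multiplicative `g` with
(1.8), upper-bound sieve weights of sifting range `z` satisfying the sieve bound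
`∑_ν λ_ν ∏_{p ∣ ν} w_ε(p) ≤ C ∏_{p<z} (1 - w_ε(p))` for FI's density `w_ε`, and any set `E` of
moduli `1 ≤ e ≤ R < z`,
`∑_{e ∈ E} ∑'_ν λ_ν g([e, ν]) ≤ C R^ε ∏_{p<z} (1 - g(p))`
(FI p. 1055–1056: positivity, the factor `(δ²/d)^ε`, extension to all `d`, the Euler product, `h`,
"the sieve theory applies", and `∏(1 - gh) = ∏(1 - g)(1 + g p^{-ε})⁻¹`).
[cite: FriedlanderIwaniecASP1998, §6 (6.5)] -/
theorem sum_sum_lcm_le_of_sieve (hg : g.IsMultiplicative)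
    (h18 : ∀ p : ℕ, p.Prime → 0 ≤ g p ∧ g p < 1) (hw : IsUpperSieveWeights z L lam) {ε C R : ℝ}
    (hε : 0 < ε) (hR : 0 < R) (hRz : R < z)
    (hB : ∑ d ∈ (primesProdBelow z).divisors,
        (lam d : ℝ) * ∏ p ∈ d.primeFactors, fiSieveDensity g ε p ≤
        C * ∏ p ∈ Nat.primesBelow ⌈z⌉₊, (1 - fiSieveDensity g ε p))
    (E : Finset ℕ) (hE : ∀ e ∈ E, e ≠ 0 ∧ (e : ℝ) ≤ R) :
    ∑ e ∈ E, ∑ ν ∈ (primesProdBelow z).divisors with Squarefree (e.lcm ν),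
        (lam ν : ℝ) * g (e.lcm ν) ≤
      C * R ^ ε * ∏ p ∈ Nat.primesBelow ⌈z⌉₊, (1 - g p) := by
  classical
  set Pd := (primesProdBelow z).divisors with hPd
  set Pz := Nat.primesBelow ⌈z⌉₊ with hPz
  have hPsq := squarefree_primesProdBelow z
  have hPdsq : ∀ ν ∈ Pd, Squarefree ν := fun ν hν =>
    hPsq.squarefree_of_dvd (Nat.dvd_of_mem_divisors hν)
  set Φ : ℕ → ℝ := fun e => ∑ ν ∈ Pd, (lam ν : ℝ) * gcp[g, e] ν with hΦ
  have hΦ0 : ∀ e, 0 ≤ Φ e := fun e => hw.sum_mul_prodPrimeFactors_ite_nonneg h18 e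
  have hg0 : ∀ e, Squarefree e → 0 ≤ g e := fun e he => by
    rw [← hg.prod_primeFactors he]
    exact Finset.prod_nonneg fun p hp => (h18 p (Nat.prime_of_mem_primeFactors hp)).1
  -- (a) the inner sums
  have inner : ∀ e : ℕ, ∑ ν ∈ Pd with Squarefree (e.lcm ν), (lam ν : ℝ) * g (e.lcm ν) =
      if Squarefree e then g e * Φ e else 0 := by
    intro e
    split_ifs with he
    · rw [Finset.filter_true_of_mem (fun ν hν => squarefree_lcm he (hPdsq ν hν)), hΦ,
        Finset.mul_sum]
      refine Finset.sum_congr rfl fun ν hν => ?_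
      rw [map_lcm_eq_mul_prodPrimeFactors_ite hg he (hPdsq ν hν)]
      ring
    · refine Finset.sum_eq_zero fun ν hν => ?_
      exact absurd (((Finset.mem_filter.mp hν).2).squarefree_of_dvd (Nat.dvd_lcm_left e ν)) he
  -- (b) Rankin's trick and extension of the range of `e`
  have step_b : ∑ e ∈ E, ∑ ν ∈ Pd with Squarefree (e.lcm ν), (lam ν : ℝ) * g (e.lcm ν) ≤
      ∑ e ∈ Pd, (R / e) ^ ε * (g e * Φ e) := by
    rw [Finset.sum_congr rfl fun e _ => inner e, ← Finset.sum_filter]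
    have hsub : E.filter Squarefree ⊆ Pd := by
      intro e he
      obtain ⟨heE, hesq⟩ := Finset.mem_filter.mp he
      refine Nat.mem_divisors.mpr
        ⟨dvd_primesProdBelow_of_squarefree hesq fun p hp => ?_, hPsq.ne_zero⟩
      have hpe : p ≤ e := Nat.le_of_mem_primeFactors hp
      calc (p : ℝ) ≤ e := by exact_mod_cast hpe
        _ ≤ R := (hE e heE).2
        _ < z := hRz
    calc ∑ e ∈ E.filter Squarefree, g e * Φ e
        ≤ ∑ e ∈ E.filter Squarefree, (R / e) ^ ε * (g e * Φ e) := by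
          refine Finset.sum_le_sum fun e he => ?_
          obtain ⟨heE, hesq⟩ := Finset.mem_filter.mp he
          refine le_mul_of_one_le_left (mul_nonneg (hg0 e hesq) (hΦ0 e)) ?_
          refine Real.one_le_rpow ?_ hε.le
          rw [le_div_iff₀ (by exact_mod_cast Nat.pos_of_ne_zero (hE e heE).1), one_mul]
          exact (hE e heE).2
      _ ≤ ∑ e ∈ Pd, (R / e) ^ ε * (g e * Φ e) :=
          Finset.sum_le_sum_of_subset_of_nonneg hsub fun e he _ =>
            mul_nonneg (Real.rpow_nonneg (div_nonneg hR.le (Nat.cast_nonneg e)) _)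
              (mul_nonneg (hg0 e (hPdsq e he)) (hΦ0 e))
  -- (c) interchange and symmetrise
  have step_c : ∑ e ∈ Pd, (R / e) ^ ε * (g e * Φ e) =
      R ^ ε * ∑ ν ∈ Pd, (lam ν : ℝ) * (g ν *
        ∑ e ∈ Pd, (e : ℝ) ^ (-ε) * gcp[g, ν] e) := by
    simp only [hΦ, Finset.mul_sum]
    rw [Finset.sum_comm]
    refine Finset.sum_congr rfl fun ν hν => Finset.sum_congr rfl fun e he => ?_
    rw [Real.div_rpow hR.le (Nat.cast_nonneg e), Real.rpow_neg (Nat.cast_nonneg e),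
      div_eq_mul_inv]
    have hsym := map_mul_prodPrimeFactors_ite_comm hg (hPdsq e he) (hPdsq ν hν)
    calc R ^ ε * ((e : ℝ) ^ ε)⁻¹ * (g e * ((lam ν : ℝ) * gcp[g, e] ν))
        = R ^ ε * ((e : ℝ) ^ ε)⁻¹ * (lam ν : ℝ) * (g e * gcp[g, e] ν) := by ring
      _ = R ^ ε * ((e : ℝ) ^ ε)⁻¹ * (lam ν : ℝ) * (g ν * gcp[g, ν] e) := by rw [hsym]
      _ = _ := by ring
  -- (d), (e): the Euler product and FI's `h`
  have step_d : ∀ ν ∈ Pd, g ν * ∑ e ∈ Pd, (e : ℝ) ^ (-ε) * gcp[g, ν] e =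
      (∏ p ∈ Pz, (1 + g p * (p : ℝ) ^ (-ε))) * ∏ p ∈ ν.primeFactors, fiSieveDensity g ε p := by
    intro ν hν
    rw [sum_divisors_rpow_neg_mul_prodPrimeFactors_ite,
      map_mul_prod_eq_prod_mul_prod_fiSieveDensity hg h18 hν]
  have hPi0 : 0 ≤ ∏ p ∈ Pz, (1 + g p * (p : ℝ) ^ (-ε)) := Finset.prod_nonneg fun p hp =>
    add_nonneg zero_le_one (mul_nonneg (h18 p (Nat.prime_of_mem_primesBelow hp)).1
      (Real.rpow_nonneg (Nat.cast_nonneg p) _))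
  -- (f) the sieve bound
  have step_f : ∑ ν ∈ Pd, (lam ν : ℝ) * (g ν * ∑ e ∈ Pd, (e : ℝ) ^ (-ε) * gcp[g, ν] e) ≤
      (∏ p ∈ Pz, (1 + g p * (p : ℝ) ^ (-ε))) * (C * ∏ p ∈ Pz, (1 - fiSieveDensity g ε p)) := by
    rw [Finset.sum_congr rfl fun ν hν => by rw [step_d ν hν]]
    have hfac : ∑ ν ∈ Pd, (lam ν : ℝ) * ((∏ p ∈ Pz, (1 + g p * (p : ℝ) ^ (-ε))) *
          ∏ p ∈ ν.primeFactors, fiSieveDensity g ε p) =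
        (∏ p ∈ Pz, (1 + g p * (p : ℝ) ^ (-ε))) *
          ∑ ν ∈ Pd, (lam ν : ℝ) * ∏ p ∈ ν.primeFactors, fiSieveDensity g ε p := by
      rw [Finset.mul_sum]
      exact Finset.sum_congr rfl fun ν _ => by ring
    rw [hfac]
    exact mul_le_mul_of_nonneg_left hB hPi0
  -- (g) assemble
  calc ∑ e ∈ E, ∑ ν ∈ Pd with Squarefree (e.lcm ν), (lam ν : ℝ) * g (e.lcm ν)
      ≤ ∑ e ∈ Pd, (R / e) ^ ε * (g e * Φ e) := step_b
    _ = R ^ ε * ∑ ν ∈ Pd, (lam ν : ℝ) * (g ν *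
        ∑ e ∈ Pd, (e : ℝ) ^ (-ε) * gcp[g, ν] e) := step_c
    _ ≤ R ^ ε * ((∏ p ∈ Pz, (1 + g p * (p : ℝ) ^ (-ε))) *
        (C * ∏ p ∈ Pz, (1 - fiSieveDensity g ε p))) :=
        mul_le_mul_of_nonneg_left step_f (Real.rpow_nonneg hR.le _)
    _ = C * R ^ ε * ((∏ p ∈ Pz, (1 + g p * (p : ℝ) ^ (-ε))) *
        ∏ p ∈ Pz, (1 - fiSieveDensity g ε p)) := by ring
    _ = C * R ^ ε * ∏ p ∈ Pz, (1 - g p) := by rw [prod_mul_prod_one_sub_fiSieveDensity h18]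

/-- `∏_{p<z} (1 - g(p)) ≪ (log z)⁻¹` by (1.9) (FI (6.5): "`∏_{p<Δ} (1 - g(p)) ≪ (log Δ)⁻¹`"):
precisely `∏_{p<z} (1 - g(p)) ≤ exp(-∑_{p ≤ z/2} g(p)) ≤ e^{-c + |K|/(log 2)^{10}} / log(z/2)` for
`z ≥ 4`. [cite: FriedlanderIwaniecASP1998, §6 (6.5)] -/
theorem prod_one_sub_density_le (h18 : ∀ p : ℕ, p.Prime → 0 ≤ g p ∧ g p < 1) {c K : ℝ}
    (h19 : ∀ y : ℝ, 2 ≤ y →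
      |(∑ p ∈ Nat.primesLE ⌊y⌋₊, g p) - (Real.log (Real.log y) + c)| ≤ K / Real.log y ^ 10)
    {z : ℝ} (hz : 4 ≤ z) :
    ∏ p ∈ Nat.primesBelow ⌈z⌉₊, (1 - g p) ≤
      Real.exp (-c + |K| / Real.log 2 ^ 10) / Real.log (z / 2) := by
  set Pz := Nat.primesBelow ⌈z⌉₊ with hPz
  have hy : 2 ≤ z / 2 := by linarith
  have hlogy : 0 < Real.log (z / 2) := Real.log_pos (by linarith)
  have hlog2 : 0 < Real.log 2 := Real.log_pos (by norm_num)
  have h1 : ∏ p ∈ Pz, (1 - g p) ≤ Real.exp (-∑ p ∈ Pz, g p) := by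
    rw [← Finset.sum_neg_distrib, Real.exp_sum]
    refine Finset.prod_le_prod (fun p hp => ?_) fun p hp => ?_
    · exact sub_nonneg.mpr (h18 p (Nat.prime_of_mem_primesBelow hp)).2.le
    · linarith [Real.add_one_le_exp (-g p)]
  have hsub : Nat.primesLE ⌊z / 2⌋₊ ⊆ Pz := by
    intro p hp
    obtain ⟨hple, hpp⟩ := Nat.mem_primesLE.mp hp
    refine Nat.mem_primesBelow.mpr ⟨Nat.lt_ceil.mpr ?_, hpp⟩
    calc (p : ℝ) ≤ ⌊z / 2⌋₊ := by exact_mod_cast hple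
      _ ≤ z / 2 := Nat.floor_le (by linarith)
      _ < z := by linarith
  have h2 : ∑ p ∈ Nat.primesLE ⌊z / 2⌋₊, g p ≤ ∑ p ∈ Pz, g p :=
    Finset.sum_le_sum_of_subset_of_nonneg hsub fun p hp _ =>
      (h18 p (Nat.prime_of_mem_primesBelow hp)).1
  have h3 := h19 (z / 2) hy
  have h4 : K / Real.log (z / 2) ^ 10 ≤ |K| / Real.log 2 ^ 10 := by
    calc K / Real.log (z / 2) ^ 10 ≤ |K| / Real.log (z / 2) ^ 10 :=
          div_le_div_of_nonneg_right (le_abs_self K) (by positivity)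
      _ ≤ |K| / Real.log 2 ^ 10 := by
          refine div_le_div_of_nonneg_left (abs_nonneg K) (by positivity) ?_
          exact pow_le_pow_left₀ hlog2.le (Real.log_le_log (by norm_num) hy) 10
  have h5 : Real.log (Real.log (z / 2)) + c - |K| / Real.log 2 ^ 10 ≤ ∑ p ∈ Pz, g p := by
    have := (abs_le.mp h3).1
    linarith
  calc ∏ p ∈ Pz, (1 - g p) ≤ Real.exp (-∑ p ∈ Pz, g p) := h1
    _ ≤ Real.exp (-(Real.log (Real.log (z / 2)) + c - |K| / Real.log 2 ^ 10)) :=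
        Real.exp_le_exp.mpr (by linarith)
    _ = Real.exp (-c + |K| / Real.log 2 ^ 10) / Real.log (z / 2) := by
        rw [show -(Real.log (Real.log (z / 2)) + c - |K| / Real.log 2 ^ 10) =
            (-c + |K| / Real.log 2 ^ 10) + -Real.log (Real.log (z / 2)) by ring, Real.exp_add,
          Real.exp_neg, Real.exp_log hlogy]
        ring

/-- **The short prime sum `L(x)` (FI (6.4))**: for `2 ≤ U ≤ V`,
`∑_{U < p ≤ V} g(p) log p ≤ log V · (log log V - log log U + 2|K| (log U)^{-10})` by (1.9).
[cite: FriedlanderIwaniecASP1998, §6 (6.4)] -/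
theorem sum_Ioc_prime_density_mul_log_le (h18 : ∀ p : ℕ, p.Prime → 0 ≤ g p ∧ g p < 1) {c K : ℝ}
    (h19 : ∀ y : ℝ, 2 ≤ y →
      |(∑ p ∈ Nat.primesLE ⌊y⌋₊, g p) - (Real.log (Real.log y) + c)| ≤ K / Real.log y ^ 10)
    {U V : ℝ} (hU : 2 ≤ U) (hUV : U ≤ V) :
    ∑ p ∈ (Ioc ⌊U⌋₊ ⌊V⌋₊).filter Nat.Prime, g p * Real.log p ≤
      Real.log V * (Real.log (Real.log V) - Real.log (Real.log U) + 2 * |K| / Real.log U ^ 10) := by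
  have hV : 2 ≤ V := hU.trans hUV
  have hlogU : 0 < Real.log U := Real.log_pos (by linarith)
  have hlogV : 0 < Real.log V := Real.log_pos (by linarith)
  have hlogUV : Real.log U ≤ Real.log V := Real.log_le_log (by linarith) hUV
  have hset : (Ioc ⌊U⌋₊ ⌊V⌋₊).filter Nat.Prime = Nat.primesLE ⌊V⌋₊ \ Nat.primesLE ⌊U⌋₊ := by
    ext p
    simp only [Finset.mem_filter, Finset.mem_Ioc, Finset.mem_sdiff, Nat.mem_primesLE]
    constructor
    · rintro ⟨⟨h1, h2⟩, hp⟩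
      exact ⟨⟨h2, hp⟩, fun h => absurd h.1 (not_le.mpr h1)⟩
    · rintro ⟨⟨h2, hp⟩, h⟩
      exact ⟨⟨not_le.mp fun h1 => h ⟨h1, hp⟩, h2⟩, hp⟩
  have hsub : Nat.primesLE ⌊U⌋₊ ⊆ Nat.primesLE ⌊V⌋₊ := Nat.primesLE_mono (Nat.floor_le_floor hUV)
  have hterm : ∀ p ∈ (Ioc ⌊U⌋₊ ⌊V⌋₊).filter Nat.Prime, g p * Real.log p ≤ Real.log V * g p := by
    intro p hp
    obtain ⟨hpI, hpp⟩ := Finset.mem_filter.mp hp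
    have hpV : (p : ℝ) ≤ V :=
      (Nat.cast_le.mpr (Finset.mem_Ioc.mp hpI).2).trans (Nat.floor_le (by linarith))
    have hp0 : (0 : ℝ) < p := by exact_mod_cast hpp.pos
    rw [mul_comm]
    exact mul_le_mul_of_nonneg_right (Real.log_le_log hp0 hpV) (h18 p hpp).1
  have hSV : ∑ p ∈ Nat.primesLE ⌊V⌋₊, g p ≤
      Real.log (Real.log V) + c + |K| / Real.log U ^ 10 := by
    have := (abs_le.mp (h19 V hV)).2
    have hK : K / Real.log V ^ 10 ≤ |K| / Real.log U ^ 10 :=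
      calc K / Real.log V ^ 10 ≤ |K| / Real.log V ^ 10 :=
            div_le_div_of_nonneg_right (le_abs_self K) (by positivity)
        _ ≤ |K| / Real.log U ^ 10 :=
            div_le_div_of_nonneg_left (abs_nonneg K) (by positivity)
              (pow_le_pow_left₀ hlogU.le hlogUV 10)
    linarith
  have hSU : Real.log (Real.log U) + c - |K| / Real.log U ^ 10 ≤
      ∑ p ∈ Nat.primesLE ⌊U⌋₊, g p := by
    have := (abs_le.mp (h19 U hU)).1
    have hK : K / Real.log U ^ 10 ≤ |K| / Real.log U ^ 10 :=
      div_le_div_of_nonneg_right (le_abs_self K) (by positivity)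
    linarith
  calc ∑ p ∈ (Ioc ⌊U⌋₊ ⌊V⌋₊).filter Nat.Prime, g p * Real.log p
      ≤ ∑ p ∈ (Ioc ⌊U⌋₊ ⌊V⌋₊).filter Nat.Prime, Real.log V * g p := Finset.sum_le_sum hterm
    _ = Real.log V * ((∑ p ∈ Nat.primesLE ⌊V⌋₊, g p) - ∑ p ∈ Nat.primesLE ⌊U⌋₊, g p) := by
        rw [← Finset.mul_sum, hset, Finset.sum_sdiff_eq_sub hsub]
    _ ≤ Real.log V * (Real.log (Real.log V) - Real.log (Real.log U) +
          2 * |K| / Real.log U ^ 10) := by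
        refine mul_le_mul_of_nonneg_left ?_ hlogV.le
        have h2K : 2 * |K| / Real.log U ^ 10 = |K| / Real.log U ^ 10 + |K| / Real.log U ^ 10 := by
          ring
        rw [h2K]
        linarith

end MainBound


/-! ### The estimate for `S₁(x; y, z)` at a fixed `x` -/

section Core

variable {A : SieveSequence} {lam : ℕ → ℤ}

/-- A prime power which is not a prime is not squarefree. [folklore] -/
theorem not_squarefree_of_isPrimePow_of_not_prime {c : ℕ} (hc : IsPrimePow c) (hp : ¬c.Prime) :
    ¬Squarefree c := by
  obtain ⟨p, k, hpp, hk, rfl⟩ := hc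
  have hp' : p.Prime := hpp.nat_prime
  have hk1 : k ≠ 1 := fun h => hp (by rw [h, pow_one]; exact hp')
  have hk2 : 2 ≤ k := by omega
  intro hsq
  refine Nat.squarefree_iff_prime_squarefree.mp hsq p hp' ?_
  rw [← pow_two]
  exact pow_dvd_pow p hk2

/-- **`S₁` at a fixed `x` (FI §6, (6.1)–(6.6) with explicit constants).** For upper-bound sieve
weights of sifting range `z₁` and level `Lev`, a sequence supported on squarefree integers with
density `g` satisfying (1.8)–(1.9), the reduced remainder bound (R′) at `x` up to level `D_x`, the
sieve bound of §6 for `w_ε` with constant `C ≥ 0`, and parameters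
`2 ≤ U < u, v`, `U² ≤ x`, `z₁ ≤ Lev < U`, `x/U² < z₁`, `z₁ ≥ 4`, `(x/U)(x/U²) Lev ≤ D_x ≤ x`:
`|∑_{n ≤ x} a_n ρ_n ∑_{bce = n, b > u, c > v} μ(b)Λ(c)| ≤ A(x) L♯ M♯ + log x · K_R A(x)(log x)^{-3}`
with `L♯ = log(x/U) (log log(x/U) - log log U + 2|K₉|(log U)^{-10})` (the bound (6.4) for `L(x)`)
and `M♯ = C (x/U²)^ε e^{-c₉ + |K₉|(log 2)^{-10}} / log(z₁/2)` (the bound (6.5) for `M(x)`).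
[cite: FriedlanderIwaniecASP1998, §6 (6.3)-(6.6)] -/
theorem abs_rhoSum_S1_le_core {x u v U z₁ Lev Dx ε C c₉ K₉ KR : ℝ}
    (hw : IsUpperSieveWeights z₁ Lev lam) (h16 : ∀ d : ℕ, ¬Squarefree d → A.congrSum d x = 0)
    (hA0 : 0 ≤ A.size x)
    (h18 : ∀ p : ℕ, p.Prime → 0 ≤ A.density p ∧ A.density p < 1)
    (h19 : ∀ y : ℝ, 2 ≤ y →
      |(∑ p ∈ Nat.primesLE ⌊y⌋₊, A.density p) - (Real.log (Real.log y) + c₉)| ≤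
        K₉ / Real.log y ^ 10)
    (hRp : ∑ m ∈ (Icc 1 ⌊Dx⌋₊).filter Squarefree, (divisorCountK 5 m : ℝ) * |A.remainder m x| ≤
      KR * A.size x / Real.log x ^ 3)
    (hε : 0 < ε) (hC : 0 ≤ C)
    (hB : ∑ d ∈ (primesProdBelow z₁).divisors,
        (lam d : ℝ) * ∏ p ∈ d.primeFactors, fiSieveDensity A.density ε p ≤
        C * ∏ p ∈ Nat.primesBelow ⌈z₁⌉₊, (1 - fiSieveDensity A.density ε p))
    (hU2 : 2 ≤ U) (huU : U < u) (hvU : U < v) (hUx : U ^ 2 ≤ x) (hLevU : Lev < U)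
    (hzLev : z₁ ≤ Lev) (hRz : x / U ^ 2 < z₁) (hz4 : 4 ≤ z₁)
    (hD : x / U * (x / U ^ 2) * Lev ≤ Dx) (hDx0 : 0 ≤ Dx) (hDx : Dx ≤ x) :
    |A.rhoSum lam (truncGT (μ : ArithmeticFunction ℝ) u * truncGT Λ v * ζ) x| ≤
      A.size x * ((Real.log (x / U) * (Real.log (Real.log (x / U)) - Real.log (Real.log U) +
          2 * |K₉| / Real.log U ^ 10)) *
        (C * (x / U ^ 2) ^ ε * (Real.exp (-c₉ + |K₉| / Real.log 2 ^ 10) / Real.log (z₁ / 2)))) +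
      Real.log x * (KR * A.size x / Real.log x ^ 3) := by
  classical
  -- positivity bookkeeping
  have hU0 : 0 < U := by linarith
  have hu0 : 0 < u := hU0.trans huU
  have hv0 : 0 < v := hU0.trans hvU
  have hU1 : 1 ≤ U ^ 2 := by nlinarith
  have hx1 : 1 ≤ x := hU1.trans hUx
  have hx0 : 0 ≤ x := by linarith
  have hxu : x / u ≤ x / U := div_le_div_of_nonneg_left hx0 hU0 huU.le
  have hxuv : x / (u * v) ≤ x / U ^ 2 := by
    rw [sq]
    exact div_le_div_of_nonneg_left hx0 (mul_pos hU0 hU0) (mul_le_mul huU.le hvU.le hU0.le hu0.le)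
  have hR0 : 0 < x / U ^ 2 := div_pos (by linarith) (by positivity)
  have hLev0 : 0 < Lev := by linarith
  set g := A.density with hg
  set Cx := Ioc ⌊v⌋₊ ⌊x / u⌋₊ with hCx
  set Ex := Icc 1 ⌊x / (u * v)⌋₊ with hEx
  set Q := Cx ×ˢ Ex with hQ
  set Pd := (primesProdBelow z₁).divisors with hPd
  set W : ℕ → ℝ := fun k => ∑ n ∈ Icc 1 ⌊x⌋₊ with k ∣ n, A.a n * (sieveRho lam n : ℝ) with hW
  set MI : ℕ → ℝ := fun k => ∑ ν ∈ Pd with Squarefree (k.lcm ν), (lam ν : ℝ) * g (k.lcm ν)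
    with hMI
  set RI : ℕ → ℝ := fun k =>
    ∑ ν ∈ Pd with Squarefree (k.lcm ν), (lam ν : ℝ) * A.remainder (k.lcm ν) x with hRI
  -- membership facts
  have hCmem : ∀ c ∈ Cx, v < c ∧ (c : ℝ) ≤ x / U := by
    intro c hc
    obtain ⟨h1, h2⟩ := Finset.mem_Ioc.mp hc
    exact ⟨(Nat.floor_lt hv0.le).mp h1,
      ((Nat.le_floor_iff (div_nonneg hx0 hu0.le)).mp h2).trans hxu⟩
  have hEmem : ∀ e ∈ Ex, e ≠ 0 ∧ (e : ℝ) ≤ x / U ^ 2 := by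
    intro e he
    obtain ⟨h1, h2⟩ := Finset.mem_Icc.mp he
    exact ⟨by omega,
      ((Nat.le_floor_iff (div_nonneg hx0 (mul_pos hu0 hv0).le)).mp h2).trans hxuv⟩
  -- Step 1: drop `μ(b)`
  have step1 : |A.rhoSum lam (truncGT (μ : ArithmeticFunction ℝ) u * truncGT Λ v * ζ) x| ≤
      ∑ q ∈ Q, Λ q.1 * W (q.1 * q.2) := by
    rw [SieveSequence.rhoSum]
    refine (Finset.abs_sum_le_sum_abs _ _).trans ?_
    have hn : ∀ n ∈ Icc 1 ⌊x⌋₊,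
        |A.a n * (sieveRho lam n : ℝ) * (truncGT (μ : ArithmeticFunction ℝ) u * truncGT Λ v * ζ) n|
          ≤ A.a n * (sieveRho lam n : ℝ) * ∑ q ∈ Q with q.1 * q.2 ∣ n, Λ q.1 := by
      intro n hn
      obtain ⟨hn1, hnx⟩ := Finset.mem_Icc.mp hn
      have hw0 : 0 ≤ A.a n * (sieveRho lam n : ℝ) :=
        mul_nonneg (A.a_nonneg n) (by exact_mod_cast hw.sieveRho_nonneg n)
      rw [abs_mul, abs_of_nonneg hw0]
      refine mul_le_mul_of_nonneg_left ?_ hw0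
      exact abs_truncGT_moebius_mul_truncGT_vonMangoldt_mul_zeta_le hu0 hv0 (by omega)
        ((Nat.le_floor_iff hx0).mp hnx)
    refine (Finset.sum_le_sum hn).trans (le_of_eq ?_)
    calc ∑ n ∈ Icc 1 ⌊x⌋₊, A.a n * (sieveRho lam n : ℝ) * ∑ q ∈ Q with q.1 * q.2 ∣ n, Λ q.1
        = ∑ n ∈ Icc 1 ⌊x⌋₊, ∑ q ∈ Q,
            if q.1 * q.2 ∣ n then A.a n * (sieveRho lam n : ℝ) * Λ q.1 else 0 := by
          refine Finset.sum_congr rfl fun n _ => ?_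
          rw [Finset.mul_sum, Finset.sum_filter]
      _ = ∑ q ∈ Q, ∑ n ∈ Icc 1 ⌊x⌋₊,
            if q.1 * q.2 ∣ n then A.a n * (sieveRho lam n : ℝ) * Λ q.1 else 0 := Finset.sum_comm
      _ = ∑ q ∈ Q, Λ q.1 * W (q.1 * q.2) := by
          refine Finset.sum_congr rfl fun q _ => ?_
          rw [← Finset.sum_filter, hW, Finset.mul_sum]
          exact Finset.sum_congr rfl fun n _ => by ring
  -- Step 2: insert (1.7)
  have step2 : ∑ q ∈ Q, Λ q.1 * W (q.1 * q.2) =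
      A.size x * ∑ q ∈ Q, Λ q.1 * MI (q.1 * q.2) + ∑ q ∈ Q, Λ q.1 * RI (q.1 * q.2) := by
    rw [Finset.mul_sum, ← Finset.sum_add_distrib]
    refine Finset.sum_congr rfl fun q _ => ?_
    have := hw.sum_filter_dvd_a_mul_sieveRho_eq_main_add_rem (A := A) (q.1 * q.2) x h16
    simp only [hW, hMI, hRI]
    rw [this]
    ring
  -- Step 3: the remainder
  have hQ0 : ∀ q ∈ Q, q.1 * q.2 ≠ 0 := by
    intro q hq
    obtain ⟨hc, he⟩ := Finset.mem_product.mp hq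
    have hc0 : 0 < q.1 := by
      have : (0 : ℝ) < q.1 := hv0.trans (hCmem q.1 hc).1
      exact_mod_cast this
    exact mul_ne_zero hc0.ne' (hEmem q.2 he).1
  have hQD : ∀ q ∈ Q, ∀ ν : ℕ, (ν : ℝ) ≤ Lev → ((q.1 * q.2 : ℕ) : ℝ) * ν ≤ Dx := by
    intro q hq ν hν
    obtain ⟨hc, he⟩ := Finset.mem_product.mp hq
    have h1 := (hCmem q.1 hc).2
    have h2 := (hEmem q.2 he).2
    calc ((q.1 * q.2 : ℕ) : ℝ) * ν = (q.1 : ℝ) * q.2 * ν := by push_cast; ring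
      _ ≤ x / U * (x / U ^ 2) * Lev := by
          refine mul_le_mul (mul_le_mul h1 h2 (Nat.cast_nonneg _) (div_nonneg hx0 hU0.le)) hν
            (Nat.cast_nonneg _) (mul_nonneg (div_nonneg hx0 hU0.le) hR0.le)
      _ ≤ Dx := hD
  have step3 : |∑ q ∈ Q, Λ q.1 * RI (q.1 * q.2)| ≤
      Real.log x * (KR * A.size x / Real.log x ^ 3) :=
    (abs_sum_vonMangoldt_mul_rem_le hw Q hx1 hDx0 hDx hQ0 hQD).trans
      (mul_le_mul_of_nonneg_left hRp (Real.log_nonneg hx1))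
  -- Step 4: the main term, `M(x)`
  set Msum := ∑ e ∈ Ex, MI e with hMsum
  have hMle : Msum ≤ C * (x / U ^ 2) ^ ε *
      (Real.exp (-c₉ + |K₉| / Real.log 2 ^ 10) / Real.log (z₁ / 2)) := by
    have h1 : Msum ≤ C * (x / U ^ 2) ^ ε * ∏ p ∈ Nat.primesBelow ⌈z₁⌉₊, (1 - g p) :=
      sum_sum_lcm_le_of_sieve A.density_mult h18 hw hε hR0 hRz hB Ex hEmem
    refine h1.trans (mul_le_mul_of_nonneg_left (prod_one_sub_density_le h18 h19 hz4) ?_)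
    exact mul_nonneg hC (Real.rpow_nonneg hR0.le _)
  have hMb0 : 0 ≤ C * (x / U ^ 2) ^ ε *
      (Real.exp (-c₉ + |K₉| / Real.log 2 ^ 10) / Real.log (z₁ / 2)) :=
    mul_nonneg (mul_nonneg hC (Real.rpow_nonneg hR0.le _))
      (div_nonneg (Real.exp_pos _).le (Real.log_nonneg (by linarith)))
  -- Step 5: the main term, `L(x)`: pull out the prime `c`
  have hc_main : ∀ c ∈ Cx, Λ c * ∑ e ∈ Ex, MI (c * e) =
      (if c.Prime then g c * Real.log c else 0) * Msum := by
    intro c hc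
    obtain ⟨hcv, hcx⟩ := hCmem c hc
    have hcU : U < c := hvU.trans hcv
    split_ifs with hp
    · rw [ArithmeticFunction.vonMangoldt_apply_prime hp, hMsum, Finset.mul_sum, Finset.mul_sum]
      refine Finset.sum_congr rfl fun e he => ?_
      have hcz : z₁ ≤ c := by linarith
      have hce : ¬c ∣ e := by
        intro hce
        have he0 := (hEmem e he).1
        have hle : (c : ℝ) ≤ e := by exact_mod_cast Nat.le_of_dvd (Nat.pos_of_ne_zero he0) hce
        linarith [(hEmem e he).2]
      simp only [hMI]
      rw [sum_lcm_prime_mul_eq A.density_mult hp hcz hce lam]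
      ring
    · by_cases hΛ : Λ c = 0
      · rw [hΛ, zero_mul, zero_mul]
      · have hpp : IsPrimePow c := by
          by_contra h
          exact hΛ (ArithmeticFunction.vonMangoldt_eq_zero_iff.mpr h)
        have hnsq := not_squarefree_of_isPrimePow_of_not_prime hpp hp
        have h0 : ∀ e ∈ Ex, MI (c * e) = 0 := by
          intro e _
          simp only [hMI]
          refine Finset.sum_eq_zero fun ν hν => ?_
          exact absurd (((Finset.mem_filter.mp hν).2.squarefree_of_dvd
            (Nat.dvd_lcm_left _ _)).squarefree_of_dvd (dvd_mul_right c e)) hnsq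
        rw [Finset.sum_congr rfl h0, Finset.sum_const_zero, mul_zero, zero_mul]
  have step5 : ∑ q ∈ Q, Λ q.1 * MI (q.1 * q.2) =
      (∑ c ∈ Cx.filter Nat.Prime, g c * Real.log c) * Msum := by
    rw [hQ, Finset.sum_product, Finset.sum_filter, Finset.sum_mul]
    refine Finset.sum_congr rfl fun c hc => ?_
    dsimp only
    rw [← Finset.mul_sum, hc_main c hc]
  -- Step 6: the bound for `L(x)`
  have hUV : U ≤ x / U := by
    rw [le_div_iff₀ hU0, ← sq]
    exact hUx
  have hL : ∑ c ∈ Cx.filter Nat.Prime, g c * Real.log c ≤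
      Real.log (x / U) * (Real.log (Real.log (x / U)) - Real.log (Real.log U) +
        2 * |K₉| / Real.log U ^ 10) := by
    have hsub : Cx.filter Nat.Prime ⊆ (Ioc ⌊U⌋₊ ⌊x / U⌋₊).filter Nat.Prime := by
      intro c hc
      obtain ⟨hcC, hp⟩ := Finset.mem_filter.mp hc
      obtain ⟨h1, h2⟩ := Finset.mem_Ioc.mp hcC
      refine Finset.mem_filter.mpr ⟨Finset.mem_Ioc.mpr ⟨?_, ?_⟩, hp⟩
      · exact lt_of_le_of_lt (Nat.floor_le_floor hvU.le) h1
      · exact h2.trans (Nat.floor_le_floor hxu)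
    refine (Finset.sum_le_sum_of_subset_of_nonneg hsub fun c hc _ => ?_).trans
      (sum_Ioc_prime_density_mul_log_le h18 h19 hU2 hUV)
    have hp := (Finset.mem_filter.mp hc).2
    exact mul_nonneg (h18 c hp).1 (Real.log_nonneg (by exact_mod_cast hp.one_lt.le))
  have hL0 : 0 ≤ ∑ c ∈ Cx.filter Nat.Prime, g c * Real.log c :=
    Finset.sum_nonneg fun c hc => by
      have hp := (Finset.mem_filter.mp hc).2
      exact mul_nonneg (h18 c hp).1 (Real.log_nonneg (by exact_mod_cast hp.one_lt.le))
  -- Step 7: assemble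
  calc |A.rhoSum lam (truncGT (μ : ArithmeticFunction ℝ) u * truncGT Λ v * ζ) x|
      ≤ ∑ q ∈ Q, Λ q.1 * W (q.1 * q.2) := step1
    _ = A.size x * ((∑ c ∈ Cx.filter Nat.Prime, g c * Real.log c) * Msum) +
          ∑ q ∈ Q, Λ q.1 * RI (q.1 * q.2) := by rw [step2, step5]
    _ ≤ A.size x * ((Real.log (x / U) * (Real.log (Real.log (x / U)) - Real.log (Real.log U) +
          2 * |K₉| / Real.log U ^ 10)) *
        (C * (x / U ^ 2) ^ ε * (Real.exp (-c₉ + |K₉| / Real.log 2 ^ 10) / Real.log (z₁ / 2)))) +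
          |∑ q ∈ Q, Λ q.1 * RI (q.1 * q.2)| := by
        refine add_le_add (mul_le_mul_of_nonneg_left ?_ hA0) (le_abs_self _)
        exact (mul_le_mul_of_nonneg_left hMle hL0).trans (mul_le_mul_of_nonneg_right hL hMb0)
    _ ≤ _ := add_le_add le_rfl step3

end Core


/-! ### Parameters for large `x` -/

section Params

/-- Powers of `log x` are eventually dominated by any positive power of `x`, with any constant.
[folklore] -/
theorem eventually_log_rpow_le_mul_rpow (r : ℝ) {s c : ℝ} (hs : 0 < s) (hc : 0 < c) :
    ∀ᶠ x : ℝ in atTop, Real.log x ^ r ≤ c * x ^ s := by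
  filter_upwards [(isLittleO_log_rpow_rpow_atTop r hs).bound hc, eventually_ge_atTop (1 : ℝ)]
    with x hx hx1
  have h1 : 0 ≤ Real.log x ^ r := Real.rpow_nonneg (Real.log_nonneg hx1) r
  have h2 : 0 ≤ x ^ s := Real.rpow_nonneg (by linarith) s
  rwa [Real.norm_of_nonneg h1, Real.norm_of_nonneg h2] at hx

/-- FI's density `w_ε(p) ≤ 1` under (1.8) (so that `∏ (1 - w_ε(p)) ≥ 0`). [folklore] -/
theorem fiSieveDensity_le_one {g : ArithmeticFunction ℝ} {p : ℕ} (hg0 : 0 ≤ g p) (hg1 : g p ≤ 1)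
    (ε : ℝ) : fiSieveDensity g ε p ≤ 1 := by
  rw [fiSieveDensity]
  have ht : 0 ≤ (p : ℝ) ^ (-ε) := Real.rpow_nonneg (Nat.cast_nonneg p) _
  have hden : 0 < 1 + g p * (p : ℝ) ^ (-ε) := by positivity
  rw [div_le_one hden]
  nlinarith

/-- **The parameter inequalities at a fixed large `x`.** With `δ = (log x)^α ≥ 2`, `U = √x/(8δ)`,
`x^{2/3} < D(x) < x` and the five "log-power versus power" inequalities, one has:
`U ≥ 2`, `U ≥ x^{1/4}`, `U² ≤ x`, `x^{θ/2} < U`, `x/U² = 64δ² < x^{θ₁}`,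
`(x/U)(x/U²) x^{θ/2} = 512 δ³ x^{1/2+θ/2} ≤ D(x)`, and `fiSLow · fiY = U`. [folklore] -/
theorem fiS1_param_bounds {D : ℝ → ℝ} {α θ θ₁ x U : ℝ} (hθ₁le : θ₁ ≤ θ / 2) (hx1 : 1 < x)
    (hR1x : x ^ (2 / 3 : ℝ) < D x ∧ D x < x ∧ 2 ≤ Real.log x ^ α ∧ 2 ≤ x ^ θ)
    (hev1 : Real.log x ^ α ≤ 1 / 16 * x ^ (1 / 2 : ℝ))
    (hev2 : Real.log x ^ α ≤ 1 / 8 * x ^ (1 / 4 : ℝ))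
    (hev3 : Real.log x ^ α ≤ 1 / 16 * x ^ (1 / 2 - θ / 2))
    (hev4 : Real.log x ^ (2 * α) ≤ 1 / 128 * x ^ θ₁)
    (hev5 : Real.log x ^ (3 * α) ≤ 1 / 512 * x ^ (1 / 6 - θ / 2))
    (hU : U = Real.sqrt x / (8 * Real.log x ^ α)) :
    2 ≤ U ∧ x ^ (1 / 4 : ℝ) ≤ U ∧ U ^ 2 ≤ x ∧ x ^ (θ / 2) < U ∧
      x ^ θ₁ ≤ x ^ (θ / 2) ∧ x / U ^ 2 < x ^ θ₁ ∧
      x / U * (x / U ^ 2) * x ^ (θ / 2) ≤ D x ∧ 0 < D x ∧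
      fiSLow D α θ x * fiY D θ x = U ∧ 0 < fiY D θ x ∧
      x / U ^ 2 = 64 * (Real.log x ^ α) ^ 2 := by
  have hx0 : 0 < x := by linarith
  have hlog0 : 0 < Real.log x := Real.log_pos hx1
  set δ := Real.log x ^ α with hδ
  have hδ2 : 2 ≤ δ := hR1x.2.2.1
  have hδ0 : 0 < δ := by linarith
  have hsx : Real.sqrt x = x ^ (1 / 2 : ℝ) := Real.sqrt_eq_rpow x
  have hsx0 : 0 < Real.sqrt x := Real.sqrt_pos.mpr hx0
  have h8δ : 0 < 8 * δ := by linarith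
  have hUdef : U = Real.sqrt x / (8 * δ) := hU
  have hU0 : 0 < U := by rw [hUdef]; exact div_pos hsx0 h8δ
  have hU8 : Real.sqrt x = 8 * δ * U := by
    rw [hUdef, mul_div_assoc', mul_comm (8 * δ), mul_div_assoc, div_self h8δ.ne', mul_one]
  have hxU : x / U = 8 * δ * Real.sqrt x := by
    rw [div_eq_iff hU0.ne']
    nth_rewrite 1 [← Real.mul_self_sqrt hx0.le]
    rw [hU8]
    ring
  have hxU2 : x / U ^ 2 = 64 * δ ^ 2 := by
    rw [div_eq_iff (pow_pos hU0 2).ne']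
    nth_rewrite 1 [← Real.mul_self_sqrt hx0.le]
    rw [hU8]
    ring
  have hU2 : 2 ≤ U := by
    rw [hUdef, le_div_iff₀ h8δ, hsx]
    linarith
  have hU14 : x ^ (1 / 4 : ℝ) ≤ U := by
    rw [hUdef, le_div_iff₀ h8δ, hsx]
    have hx14 : 0 < x ^ (1 / 4 : ℝ) := Real.rpow_pos_of_pos hx0 _
    have hsplit : x ^ (1 / 2 : ℝ) = x ^ (1 / 4 : ℝ) * x ^ (1 / 4 : ℝ) := by
      rw [← Real.rpow_add hx0]; norm_num
    rw [hsplit]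
    have h8 : 8 * δ ≤ x ^ (1 / 4 : ℝ) := by linarith
    exact mul_le_mul_of_nonneg_left h8 hx14.le
  have hUx : U ^ 2 ≤ x := by
    have hUle : U ≤ Real.sqrt x := by
      rw [hUdef, div_le_iff₀ h8δ]
      have : 1 ≤ 8 * δ := by linarith
      calc Real.sqrt x = Real.sqrt x * 1 := (mul_one _).symm
        _ ≤ Real.sqrt x * (8 * δ) := mul_le_mul_of_nonneg_left this hsx0.le
    calc U ^ 2 ≤ Real.sqrt x ^ 2 := pow_le_pow_left₀ hU0.le hUle 2
      _ = x := Real.sq_sqrt hx0.le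
  have hLevU : x ^ (θ / 2) < U := by
    rw [hUdef, lt_div_iff₀ h8δ, hsx]
    have hxθ : 0 < x ^ (θ / 2) := Real.rpow_pos_of_pos hx0 _
    have hsplit : x ^ (1 / 2 : ℝ) = x ^ (1 / 2 - θ / 2) * x ^ (θ / 2) := by
      rw [← Real.rpow_add hx0]; ring_nf
    rw [hsplit]
    have hxs : 0 < x ^ (1 / 2 - θ / 2) := Real.rpow_pos_of_pos hx0 _
    have h8 : 8 * δ < x ^ (1 / 2 - θ / 2) := by linarith
    calc x ^ (θ / 2) * (8 * δ) < x ^ (θ / 2) * x ^ (1 / 2 - θ / 2) :=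
          mul_lt_mul_of_pos_left h8 hxθ
      _ = x ^ (1 / 2 - θ / 2) * x ^ (θ / 2) := mul_comm _ _
  have hzLev : x ^ θ₁ ≤ x ^ (θ / 2) := Real.rpow_le_rpow_of_exponent_le hx1.le hθ₁le
  have hz0 : 0 < x ^ θ₁ := Real.rpow_pos_of_pos hx0 _
  have hRz : x / U ^ 2 < x ^ θ₁ := by
    rw [hxU2]
    have h2 : δ ^ 2 = Real.log x ^ (2 * α) := by
      rw [hδ, ← Real.rpow_natCast, ← Real.rpow_mul hlog0.le]; ring_nf
    rw [h2]
    linarith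
  have hD : x / U * (x / U ^ 2) * x ^ (θ / 2) ≤ D x := by
    rw [hxU, hxU2]
    have h3 : δ ^ 3 = Real.log x ^ (3 * α) := by
      rw [hδ, ← Real.rpow_natCast, ← Real.rpow_mul hlog0.le]; ring_nf
    have hx23 : x ^ (2 / 3 : ℝ) = x ^ (1 / 6 - θ / 2) * x ^ (1 / 2 : ℝ) * x ^ (θ / 2) := by
      rw [← Real.rpow_add hx0, ← Real.rpow_add hx0]; ring_nf
    have hxθ : 0 < x ^ (θ / 2) := Real.rpow_pos_of_pos hx0 _
    have hx12 : 0 < x ^ (1 / 2 : ℝ) := Real.rpow_pos_of_pos hx0 _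
    calc 8 * δ * Real.sqrt x * (64 * δ ^ 2) * x ^ (θ / 2)
        = 512 * Real.log x ^ (3 * α) * x ^ (1 / 2 : ℝ) * x ^ (θ / 2) := by
          rw [hsx, ← h3]; ring
      _ ≤ 512 * (1 / 512 * x ^ (1 / 6 - θ / 2)) * x ^ (1 / 2 : ℝ) * x ^ (θ / 2) := by
          gcongr
      _ = x ^ (2 / 3 : ℝ) := by rw [hx23]; ring
      _ ≤ D x := hR1x.1.le
  have hD0 : 0 < D x := lt_of_le_of_lt (Real.rpow_pos_of_pos hx0 (2 / 3 : ℝ)).le hR1x.1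
  have hsD : 0 < Real.sqrt (D x) := Real.sqrt_pos.mpr hD0
  have hxθ2 : 0 < x ^ (θ / 2) := Real.rpow_pos_of_pos hx0 _
  have hY0 : 0 < fiY D θ x := div_pos hsD hxθ2
  have hSY : fiSLow D α θ x * fiY D θ x = U := by
    rw [fiSLow, fiY, hUdef, hδ]
    field_simp
  exact ⟨hU2, hU14, hUx, hLevU, hzLev, hRz, hD, hD0, hSY, hY0, hxU2⟩

/-- **The bound for `L(x)` in final form**: with `ℓ = log x ≥ 4`, `log ℓ ≥ 1`, `ℓ/4 ≤ log U`,
`0 ≤ log(x/U) ≤ ℓ` and `log(x/U) - log U = log 64 + 2α log ℓ`,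
`log(x/U) (log log(x/U) - log log U + 2|K| (log U)^{-10}) ≤ (4 log 64 + 8α + 8|K|) log ℓ`
(FI (6.4): `L(x) ≪ log δ`). [cite: FriedlanderIwaniecASP1998, §6 (6.4)] -/
theorem fiS1_L_final {ℓ a b α K : ℝ} (hℓ4 : 4 ≤ ℓ) (hLL1 : 1 ≤ Real.log ℓ) (hb : ℓ / 4 ≤ b)
    (ha : a ≤ ℓ) (ha0 : 0 ≤ a) (hα : 0 < α) (hdiff : a - b = Real.log 64 + 2 * α * Real.log ℓ) :
    a * (Real.log a - Real.log b + 2 * |K| / b ^ 10) ≤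
      (4 * Real.log 64 + 8 * α + 8 * |K|) * Real.log ℓ := by
  have hℓ0 : 0 < ℓ := by linarith
  have hb1 : 1 ≤ b := by linarith
  have hb0 : 0 < b := by linarith
  have h64 : 0 ≤ Real.log 64 := Real.log_nonneg (by norm_num)
  have hnum0 : 0 ≤ Real.log 64 + 2 * α * Real.log ℓ := by positivity
  have hab : b ≤ a := by linarith
  have hapos : 0 < a := hb0.trans_le hab
  have hLL : Real.log a - Real.log b ≤ 4 * (Real.log 64 + 2 * α * Real.log ℓ) / ℓ := by
    rw [← Real.log_div hapos.ne' hb0.ne']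
    calc Real.log (a / b) ≤ a / b - 1 := Real.log_le_sub_one_of_pos (div_pos hapos hb0)
      _ = (a - b) / b := by field_simp
      _ = (Real.log 64 + 2 * α * Real.log ℓ) / b := by rw [hdiff]
      _ ≤ (Real.log 64 + 2 * α * Real.log ℓ) / (ℓ / 4) :=
          div_le_div_of_nonneg_left hnum0 (by positivity) hb
      _ = 4 * (Real.log 64 + 2 * α * Real.log ℓ) / ℓ := by ring
  have hK : 2 * |K| / b ^ 10 ≤ 8 * |K| / ℓ := by
    have h10 : b ≤ b ^ 10 := le_self_pow₀ hb1 (by norm_num)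
    calc 2 * |K| / b ^ 10 ≤ 2 * |K| / b := div_le_div_of_nonneg_left (by positivity) hb0 h10
      _ ≤ 2 * |K| / (ℓ / 4) := div_le_div_of_nonneg_left (by positivity) (by positivity) hb
      _ = 8 * |K| / ℓ := by ring
  have hX : Real.log a - Real.log b + 2 * |K| / b ^ 10 ≤
      (4 * Real.log 64 + 8 * α * Real.log ℓ + 8 * |K|) / ℓ := by
    refine (add_le_add hLL hK).trans (le_of_eq ?_)
    ring
  have hX0 : 0 ≤ (4 * Real.log 64 + 8 * α * Real.log ℓ + 8 * |K|) / ℓ := by positivity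
  calc a * (Real.log a - Real.log b + 2 * |K| / b ^ 10)
      ≤ a * ((4 * Real.log 64 + 8 * α * Real.log ℓ + 8 * |K|) / ℓ) :=
        mul_le_mul_of_nonneg_left hX ha0
    _ ≤ ℓ * ((4 * Real.log 64 + 8 * α * Real.log ℓ + 8 * |K|) / ℓ) :=
        mul_le_mul_of_nonneg_right ha hX0
    _ = 4 * Real.log 64 + 8 * α * Real.log ℓ + 8 * |K| := by field_simp
    _ ≤ (4 * Real.log 64 + 8 * α + 8 * |K|) * Real.log ℓ := by nlinarith [abs_nonneg K]

/-- **The bound for `M(x)` in final form**: with `R^ε ≤ e`, `θ₁ ℓ / 2 ≤ log(z₁/2)`,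
`C' R^ε e^{C₀} / log(z₁/2) ≤ (2 C' e^{1 + C₀} / θ₁) / ℓ` (FI (6.5): `M(x) ≪ (log Δ)⁻¹`).
[cite: FriedlanderIwaniecASP1998, §6 (6.5)] -/
theorem fiS1_M_final {ℓ θ₁ C' C₀ Rε Lz : ℝ} (hℓ0 : 0 < ℓ) (hθ₁ : 0 < θ₁) (hC' : 0 ≤ C')
    (hRε : Rε ≤ Real.exp 1) (hLz : θ₁ * ℓ / 2 ≤ Lz) :
    C' * Rε * (Real.exp C₀ / Lz) ≤ 2 * C' * (Real.exp 1 * Real.exp C₀) / θ₁ / ℓ := by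
  have hLz0 : 0 < θ₁ * ℓ / 2 := by positivity
  calc C' * Rε * (Real.exp C₀ / Lz)
      ≤ C' * Real.exp 1 * (Real.exp C₀ / (θ₁ * ℓ / 2)) := by
        refine mul_le_mul (mul_le_mul_of_nonneg_left hRε hC')
          (div_le_div_of_nonneg_left (Real.exp_pos _).le hLz0 hLz) ?_ (by positivity)
        exact div_nonneg (Real.exp_pos _).le (hLz0.le.trans hLz)
    _ = 2 * C' * (Real.exp 1 * Real.exp C₀) / θ₁ / ℓ := by field_simp

/-- **Combination of the three bounds** into `K A(x) log log x / log x`. [folklore] -/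
theorem fiS1_combine {Asz ℓ Lb Mb KL KM KR Rm : ℝ} (hA : 0 ≤ Asz) (hℓ1 : 1 ≤ ℓ)
    (hLL1 : 1 ≤ Real.log ℓ) (hKL : 0 ≤ KL) (hMb0 : 0 ≤ Mb) (hLb : Lb ≤ KL * Real.log ℓ)
    (hMb : Mb ≤ KM / ℓ) (hRm : Rm ≤ ℓ * (KR * Asz / ℓ ^ 3)) :
    Asz * (Lb * Mb) + Rm ≤ (KL * KM + |KR|) * Asz * Real.log ℓ / ℓ := by
  have hℓ0 : 0 < ℓ := by linarith
  have h1 : Lb * Mb ≤ KL * Real.log ℓ * (KM / ℓ) :=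
    (mul_le_mul_of_nonneg_right hLb hMb0).trans
      (mul_le_mul_of_nonneg_left hMb (mul_nonneg hKL (by linarith)))
  have h2 : Asz * (Lb * Mb) ≤ KL * KM * Asz * Real.log ℓ / ℓ := by
    refine (mul_le_mul_of_nonneg_left h1 hA).trans (le_of_eq ?_)
    field_simp
  have h3 : ℓ * (KR * Asz / ℓ ^ 3) ≤ |KR| * Asz * Real.log ℓ / ℓ := by
    have h1' : ℓ * (KR * Asz / ℓ ^ 3) = KR * Asz / ℓ ^ 2 := by field_simp
    rw [h1', div_le_div_iff₀ (by positivity) hℓ0]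
    have hKA : KR * Asz ≤ |KR| * Asz := mul_le_mul_of_nonneg_right (le_abs_self KR) hA
    have h0 : 0 ≤ |KR| * Asz := mul_nonneg (abs_nonneg _) hA
    calc KR * Asz * ℓ ≤ |KR| * Asz * ℓ := mul_le_mul_of_nonneg_right hKA hℓ0.le
      _ = |KR| * Asz * 1 * ℓ := by ring
      _ ≤ |KR| * Asz * Real.log ℓ * ℓ ^ 2 := by
          rw [sq, ← mul_assoc]
          refine mul_le_mul_of_nonneg_right ?_ hℓ0.le
          calc |KR| * Asz * 1 ≤ |KR| * Asz * Real.log ℓ := mul_le_mul_of_nonneg_left hLL1 h0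
            _ = |KR| * Asz * Real.log ℓ * 1 := (mul_one _).symm
            _ ≤ |KR| * Asz * Real.log ℓ * ℓ :=
                mul_le_mul_of_nonneg_left hℓ1 (mul_nonneg h0 (by linarith))
  calc Asz * (Lb * Mb) + Rm ≤ KL * KM * Asz * Real.log ℓ / ℓ + |KR| * Asz * Real.log ℓ / ℓ :=
        add_le_add h2 (hRm.trans h3)
    _ = (KL * KM + |KR|) * Asz * Real.log ℓ / ℓ := by ring

end Params

/-! ### The discharge of `fi_asp_S1_estimate` -/

section Final

/-- **Discharge of `fi_asp_S1_estimate` (FI §6, (6.6)):** in the regime `FIRegime`, for weights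
satisfying the sieve bound of §6, `|S₁(x; y, z)| ≤ K A(x) log log x / log x` for all large `x`,
every admissible `s` and all `y, z ∈ [Y, eY]`. The proof is FI's: drop `μ(b)` (the ranges (6.1),
(6.2): `c > sz > U = √x/(8δ)`, `c ≤ x/(sy) < 8δ√x`, `d < 64δ²`), write
`∑_{cd ∣ n} ρ_n a_n = ∑_ν λ_ν A_{[cd,ν]}(x)`, insert (1.7), bound the remainder by (R′)
(`[cd, ν] ≤ cdν < 512 δ³ x^{1/2 + θ/2} < D`), factor the main term as `A(x) L(x) M(x)` using that
`c` is a prime exceeding `d` and `ν`, bound `L(x) ≪ log δ` by (1.9) and `M(x) ≪ (log Δ)⁻¹` by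
positivity, Rankin's trick with `ε = (log x)⁻¹`, the sieve bound and (1.9).
[cite: FriedlanderIwaniecASP1998, §6 (6.1)-(6.6)] -/
theorem fi_asp_S1_estimate_holds : fi_asp_S1_estimate := by
  intro A D α θ θ₁ lam hreg hBex
  classical
  obtain ⟨C, hBev⟩ := hBex
  have hα := hreg.α_pos
  have hθ₁ := hreg.θ₁_pos
  have hθ₁le := hreg.θ₁_le
  have hθ3 := hreg.θ_lt
  have hθ : 0 < θ := by linarith
  have hhyp := hreg.hyp
  have hsize := hhyp.1
  obtain ⟨K₈, h18K⟩ := hhyp.2.2.2.1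
  have h18 : ∀ p : ℕ, p.Prime → 0 ≤ A.density p ∧ A.density p < 1 := fun p hp =>
    ⟨(h18K p hp).1, (h18K p hp).2.1⟩
  obtain ⟨c₉, K₉, h19⟩ := hhyp.2.2.2.2.1
  have h16 : ∀ x : ℝ, ∀ d : ℕ, ¬Squarefree d → A.congrSum d x = 0 := fun x d hd => by
    rw [SieveSequence.congrSum]
    exact Finset.sum_eq_zero fun n hn =>
      hhyp.a_eq_zero fun hsq => hd (hsq.squarefree_of_dvd (Finset.mem_filter.mp hn).2)
  have hR1 := hhyp.2.2.2.2.2.2.1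
  obtain ⟨KR, hRp⟩ := fi_reduced_remainder_bound_holds A D _ _ hhyp
  -- the constants
  set C' := max C 0 with hC'
  have hC'0 : 0 ≤ C' := le_max_right _ _
  set C₀ := -c₉ + |K₉| / Real.log 2 ^ 10 with hC₀
  set KL := 4 * Real.log 64 + 8 * α + 8 * |K₉| with hKL
  set KM := 2 * C' * (Real.exp 1 * Real.exp C₀) / θ₁ with hKM
  have hKL0 : 0 ≤ KL := by
    have : 0 ≤ Real.log 64 := Real.log_nonneg (by norm_num)
    positivity
  refine ⟨KL * KM + |KR|, ?_⟩
  -- eventual inequalities between the parameters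
  have ev1 := eventually_log_rpow_le_mul_rpow α (s := 1 / 2) (c := 1 / 16) (by norm_num)
    (by norm_num)
  have ev2 := eventually_log_rpow_le_mul_rpow α (s := 1 / 4) (c := 1 / 8) (by norm_num)
    (by norm_num)
  have ev3 := eventually_log_rpow_le_mul_rpow α (s := 1 / 2 - θ / 2) (c := 1 / 16)
    (by linarith) (by norm_num)
  have ev4 := eventually_log_rpow_le_mul_rpow (2 * α) (s := θ₁) (c := 1 / 128) hθ₁ (by norm_num)
  have ev5 := eventually_log_rpow_le_mul_rpow (3 * α) (s := 1 / 6 - θ / 2) (c := 1 / 512)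
    (by linarith) (by norm_num)
  have ev6 := (tendsto_rpow_atTop hθ₁).eventually_ge_atTop (4 : ℝ)
  have ev7 := Real.tendsto_log_atTop.eventually_ge_atTop
    (max 4 (max (Real.exp 1) (2 * Real.log 2 / θ₁)))
  filter_upwards [hreg.weights, hBev, hRp, hR1, ev1, ev2, ev3, ev4, ev5, ev6, ev7,
    eventually_gt_atTop (1 : ℝ)] with x hwx hBx hRx hR1x hev1 hev2 hev3 hev4 hev5 hev6 hev7 hx1
  intro s hs y hy1 hy2 z hz1 hz2
  -- basic quantities at `x`
  have hx0 : 0 < x := lt_trans one_pos hx1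
  have hlog4 : 4 ≤ Real.log x := le_trans (le_max_left _ _) hev7
  have hloge : Real.exp 1 ≤ Real.log x :=
    le_trans ((le_max_left _ _).trans (le_max_right _ _)) hev7
  have hlogθ : 2 * Real.log 2 / θ₁ ≤ Real.log x :=
    le_trans ((le_max_right _ _).trans (le_max_right _ _)) hev7
  have hlog1 : 1 ≤ Real.log x := le_trans (by norm_num) hlog4
  have hlog0 : 0 < Real.log x := lt_of_lt_of_le one_pos hlog1
  have hLL1 : 1 ≤ Real.log (Real.log x) := by
    rw [← Real.log_exp 1]
    exact Real.log_le_log (Real.exp_pos 1) hloge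
  obtain ⟨U, hU⟩ : ∃ U : ℝ, U = Real.sqrt x / (8 * Real.log x ^ α) := ⟨_, rfl⟩
  obtain ⟨hU2, hU14, hUx, hLevU, hzLev, hRz, hD, hD0, hSY, hY0, hxU2⟩ :=
    fiS1_param_bounds (D := D) hθ₁le hx1 hR1x hev1 hev2 hev3 hev4 hev5 hU
  have hU0 : 0 < U := lt_of_lt_of_le two_pos hU2
  have hU1 : 1 ≤ U := le_trans one_le_two hU2
  have hz4 : 4 ≤ x ^ θ₁ := hev6
  have hz0 : 0 < x ^ θ₁ := lt_of_lt_of_le four_pos hz4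
  have hDx0 : 0 ≤ D x := hD0.le
  have hDx : D x ≤ x := hR1x.2.1.le
  -- `U < sy`, `U < sz`
  have hs0 : 0 < s := by
    obtain ⟨⟨k, rfl⟩, -, -⟩ := hs
    exact pow_pos two_pos k
  have hsU : U < s * fiY D θ x := by
    rw [← hSY]
    exact mul_lt_mul_of_pos_right hs.2.1 hY0
  have hsy : U < s * y := hsU.trans_le (mul_le_mul_of_nonneg_left hy1 hs0.le)
  have hsz : U < s * z := hsU.trans_le (mul_le_mul_of_nonneg_left hz1 hs0.le)
  -- `ε = 1/log x`, the sieve bound with `C' ≥ 0`, (R′) at `t = x`, `A(x) ≥ 0`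
  set ε := 1 / Real.log x with hε
  have hε0 : 0 < ε := one_div_pos.mpr hlog0
  have hε1 : ε ≤ 1 := (div_le_one hlog0).mpr hlog1
  have hBx' : ∑ d ∈ (primesProdBelow (x ^ θ₁)).divisors,
      (lam x d : ℝ) * ∏ p ∈ d.primeFactors, fiSieveDensity A.density ε p ≤
      C' * ∏ p ∈ Nat.primesBelow ⌈x ^ θ₁⌉₊, (1 - fiSieveDensity A.density ε p) := by
    refine (hBx ε hε0 hε1).trans (mul_le_mul_of_nonneg_right (le_max_left _ _) ?_)
    exact Finset.prod_nonneg fun p hp => sub_nonneg.mpr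
      (fiSieveDensity_le_one (h18 p (Nat.prime_of_mem_primesBelow hp)).1
        (h18 p (Nat.prime_of_mem_primesBelow hp)).2.le ε)
  have hRx' := hRx x le_rfl
  have hA0 : 0 ≤ A.size x := by
    rw [hsize]
    exact A.congrSum_nonneg 1 x
  -- the core estimate
  have core := abs_rhoSum_S1_le_core (A := A) hwx (h16 x) hA0 h18 h19 hRx' hε0 hC'0 hBx' hU2 hsy hsz
    hUx hLevU hzLev hRz hz4 hD hDx0 hDx
  rw [SieveSequence.fiS1]
  refine core.trans ?_
  -- post-processing
  have hlogU : Real.log x / 4 ≤ Real.log U := by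
    have := Real.log_le_log (Real.rpow_pos_of_pos hx0 _) hU14
    rwa [Real.log_rpow hx0, one_div_mul_eq_div] at this
  have hlogxU : Real.log (x / U) ≤ Real.log x :=
    Real.log_le_log (div_pos hx0 hU0) (div_le_self hx0.le hU1)
  have hxUU : U ≤ x / U := by
    rw [le_div_iff₀ hU0, ← sq]
    exact hUx
  have hlogxU0 : 0 ≤ Real.log (x / U) := Real.log_nonneg (hU1.trans hxUU)
  have hdiff : Real.log (x / U) - Real.log U = Real.log 64 + 2 * α * Real.log (Real.log x) := by
    rw [← Real.log_div (div_pos hx0 hU0).ne' hU0.ne', div_div, ← sq, hxU2,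
      Real.log_mul (by norm_num) (by positivity), ← Real.rpow_natCast,
      ← Real.rpow_mul hlog0.le, Real.log_rpow hlog0]
    push_cast
    ring
  have hLb := fiS1_L_final (K := K₉) hlog4 hLL1 hlogU hlogxU hlogxU0 hα hdiff
  have hRε0 : 0 ≤ (x / U ^ 2) ^ ε := Real.rpow_nonneg (div_nonneg hx0.le (sq_nonneg U)) _
  have hRε : (x / U ^ 2) ^ ε ≤ Real.exp 1 := by
    have hRx1 : x / U ^ 2 ≤ x := by
      refine hRz.le.trans ?_
      calc x ^ θ₁ ≤ x ^ (1 : ℝ) := Real.rpow_le_rpow_of_exponent_le hx1.le (by linarith)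
        _ = x := Real.rpow_one x
    calc (x / U ^ 2) ^ ε ≤ x ^ ε :=
          Real.rpow_le_rpow (div_nonneg hx0.le (sq_nonneg U)) hRx1 hε0.le
      _ = Real.exp 1 := by
          rw [Real.rpow_def_of_pos hx0, hε, mul_one_div_cancel hlog0.ne']
  have hlogz : θ₁ * Real.log x / 2 ≤ Real.log (x ^ θ₁ / 2) := by
    rw [Real.log_div hz0.ne' (by norm_num), Real.log_rpow hx0]
    have h2 : 2 * Real.log 2 ≤ θ₁ * Real.log x := by
      have := (div_le_iff₀ hθ₁).mp hlogθ
      linarith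
    linarith
  have hMb := fiS1_M_final (C₀ := C₀) hlog0 hθ₁ hC'0 hRε hlogz
  have hMb0 : 0 ≤ C' * (x / U ^ 2) ^ ε *
      (Real.exp (-c₉ + |K₉| / Real.log 2 ^ 10) / Real.log (x ^ θ₁ / 2)) :=
    mul_nonneg (mul_nonneg hC'0 hRε0)
      (div_nonneg (Real.exp_pos _).le ((by positivity : (0:ℝ) ≤ θ₁ * Real.log x / 2).trans hlogz))
  exact fiS1_combine hA0 hlog1 hLL1 hKL0 hMb0 hLb hMb le_rfl

end Final

end Literature.NumberTheory.Sieve
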